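import Literature.Analysis.FunctionSpaces.LorentzGas
import Literature.Analysis.FluidPDE.BoltzmannEquationProofs
import HarnessLib

/-!
# Global well-posedness of the linear Boltzmann equation
(topic Analysis/FunctionSpaces, next to `LorentzGas`; discharges the named fact
`Literature.Analysis.FunctionSpaces.existsUnique_mildLinearBoltzmann` of that file)

Main result: `Literature.Analysis.FunctionSpaces.existsUnique_mildLinearBoltzmann_holds` — for a
geometry `G` with jointly continuous translations on an ARBITRARY topological position space `X`,
a continuous Grad cut-off kernel `B` and continuous data `0 ≤ f₀ ≤ C M` (`M` the global
Maxwellian), the linear Boltzmann equation `∂ₜ f + v·∇ₓ f = Q_B(f, M)` of a tagged particle in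
the Maxwellian background (Bodineau–Gallagher–Saint-Raymond, Invent. Math. 203 (2016), (1.7) and
§2, (2.3)) has a mild solution on every `[0, T]` which is jointly continuous with `|f| ≤ C M`
(`IsMildLinearBoltzmannSolutionOn`, `IsMaxwellianBoundedOn`), and this solution is unique on
`t ≥ 0` in that class. BGSR invoke exactly this structure ("the maximum principle for the linear
Boltzmann equation", §3.3: `sup_t φ_α ≤ ‖ρ⁰‖_∞`); the proof below is the classical
monotone-scheme / maximum-principle argument (cf. Cercignani–Illner–Pulvirenti 1994, Ch. 8, for
linear transport with gain and loss), organised as follows. All auxiliary results live in the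
sub-namespace `Literature.Analysis.FunctionSpaces.LinearBoltzmann`; the file declares theorems
only.

* **A. Parametric integrals over a general parameter space.** The fact quantifies over every
  topological `X`, so Mathlib's dominated-convergence continuity lemmas (first countable
  parameters) do not apply to the position variable. `continuous_integral_of_continuous_uncurry`
  (compact integration space, from Mathlib's `continuousOn_integral_of_compact_support`) and
  `continuousAt_integral_of_continuous_of_dominated` (proper metric integration space: uniform
  convergence on compact balls by the generalised tube lemma
  `IsCompact.eventually_forall_of_forall_eventually`, small tails by domination) give continuity
  of parametric integrals for an arbitrary topological parameter space; the time integrals use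
  Mathlib's `intervalIntegral.continuous_parametric_intervalIntegral_of_continuous` (general `X`).
* **B. Velocity estimates.** `M(v') M(v_*') = M(v) M(v_*)` and `|v'|² ≤ |v|² + |v_*|²`
  (conservation of energy) transfer the weight `W_s = M e^{s(1+|·|²)}` through a collision at the
  price of a factor `e^{s|v_*|²}`, integrable against `(1+|v_*|) M(v_*)` for `s ≤ 1/4`
  (`exists_kernel_bounds`: constants `κ`, `b` with `ν(v) = ∫∫ B M ≤ κ(1+|v|)` and
  `∫∫ B |φ(v')| M(v_*') ≤ N κ (1+|v|) W_s(v)` whenever `|φ| ≤ N W_s`). Section B' derives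
  integrability of the gain/loss integrands, the splitting `Q_B(φ, M) = K φ - φ ν`
  (`collisionOpWith_globalMaxwellian_eq`), additivity and monotonicity of the gain term `K`,
  continuity of `ν` and of `(p, v) ↦ K(Φ p)(v)` over a general parameter space, and dominated
  convergence for `K`.
* **C. The exponential Duhamel map** `Φ(g)(t, y, v) = e^{-ν t⁺} f₀(y - t⁺v, v) +
  ∫₀^{t⁺} e^{-ν(t⁺-τ)} (K g)(τ, y-(t⁺-τ)v, v) dτ`, `t⁺ = max t 0` (so that `Φ(g)(t) = f₀` for
  `t ≤ 0`): joint continuity, monotonicity in (data, density), additivity, the fixed point `C M`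
  for the data `C M` (`K(CM) = C M ν`, `e^{-νt} + ∫₀ᵗ ν e^{-ν(t-τ)} dτ = 1`), dominated
  convergence. To keep the file free of definitions, `Φ` enters the later statements as a
  variable characterised by the hypothesis `hΦ`. C'. The increasing iteration `Φⁿ(0)`:
  continuous, `0 ≤ Φⁿ(0) ≤ C M` (maximum principle), convergent; the limit is a fixed point with
  measurable velocity slices.
* **E. Uniqueness on short strips** (`exists_strip_width`): on `[a, a + T₀]`, `T₀ = 1/(4Λ)`,
  `Λ = 8κ + 1`, a Duhamel-type inequality `|u(t)| ≤ |∫ₐᵗ D|`, `|D| ≤ |K u| + ν |u|` improves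
  `|u| ≤ N W_{Λ(τ-a)}` to `|u| ≤ (N/2) W_{Λ(τ-a)}`, hence `u = 0`; no measurability of `u` is
  needed. Consequences: uniqueness of Maxwellian-bounded fixed points of `Φ`
  (`expDuhamel_fixedPoint_unique`) and uniqueness of mild solutions in the Maxwellian-weighted
  continuous class (`mildLinearBoltzmann_unique`), both by induction over consecutive strips.
* **F./G. Assembly.** Continuity of the limit `f`: the iteration for the complementary data
  `C M - f₀` has limit `k` with `f + k` a bounded fixed point for the data `C M`, hence
  `f + k = C M` by uniqueness, so `f` is lower and upper semicontinuous
  (`continuous_of_monotone_approx`). Along characteristics the exponential form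
  `F(t) = e^{-νt}(F(0) + ∫₀ᵗ e^{ντ} q)` is differentiable with `F' = q - νF`, which integrates to
  Duhamel's formula (`isMildLinearBoltzmannSolutionOn_of_expDuhamel`).

## Mathlib / tree search

Mathlib has no linear Boltzmann / transport-with-collisions well-posedness (searched `Boltzmann`,
`Duhamel`, `mild`). Reused from Mathlib: `continuousOn_integral_of_compact_support`,
`IsCompact.eventually_forall_of_forall_eventually`, `tendsto_setIntegral_of_antitone`,
`intervalIntegral.continuous_parametric_intervalIntegral_of_continuous`,
`intervalIntegral.tendsto_integral_filter_of_dominated_convergence`,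
`tendsto_integral_of_dominated_convergence`, `StronglyMeasurable.integral_prod_right'`,
`measurable_of_tendsto_metrizable`, `tendsto_atTop_ciSup`, `Continuous.integral_hasStrictDerivAt`,
`intervalIntegral.integral_eq_sub_of_hasDerivAt`, `intervalIntegral.norm_integral_le_of_norm_le`.
From the tree (`Literature.Analysis.FluidPDE.BoltzmannEquationProofs`): `continuous_collide_uncurry`,
`one_add_norm_sub_le`, `exp_collide_mul_exp_collide`, `IsGradCutoffKernel.exists_bound_nonneg`,
`isFiniteMeasure_sphereMeasure`, `integrable_one_add_norm_mul_exp`. The tree file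
`Literature.MathematicalPhysics.KineticTheory.TaggedLinearBoltzmannSeries` treats the hard-sphere
kernel on locally compact first countable position spaces by a Dyson series and records that it
does not discharge the present general statement; nothing of it is used here.

## References

* T. Bodineau, I. Gallagher, L. Saint-Raymond, *The Brownian motion as the limit of a
  deterministic system of hard-spheres*, Invent. Math. 203 (2016) 493–553 (arXiv:1305.3397),
  (1.7), §2 (2.3), §3.3 (maximum principle for the linear Boltzmann equation).
  [BodineauGallagherSaintRaymond2016]
* C. Cercignani, R. Illner, M. Pulvirenti, *The Mathematical Theory of Dilute Gases*, Springer
  (1994), Ch. 8.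
* H. Spohn, *Kinetic equations from Hamiltonian dynamics*, Rev. Mod. Phys. 52 (1980) 569–615.
-/

open MeasureTheory Metric Real Set Filter Topology
open scoped InnerProductSpace ENNReal
open Literature.MathematicalPhysics.KineticTheory (collide sphereMeasure)
open Literature.Analysis.FluidPDE

namespace Literature.Analysis.FunctionSpaces

noncomputable section

namespace LinearBoltzmann

/-! ## A. Parametric integrals over a general parameter space -/

section Parametric

variable {P Y : Type*} [TopologicalSpace P]

/-- A parametric integral over a compact space of a jointly continuous integrand is continuous,
for an ARBITRARY topological parameter space (no first countability: uniform continuity on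
compacts, Mathlib's `continuousOn_integral_of_compact_support`). [folklore] -/
theorem continuous_integral_of_continuous_uncurry [TopologicalSpace Y] [MeasurableSpace Y]
    [OpensMeasurableSpace Y] [CompactSpace Y] {μ : Measure Y} [IsFiniteMeasureOnCompacts μ]
    {F : P → Y → ℝ} (hF : Continuous (Function.uncurry F)) :
    Continuous fun p => ∫ y, F p y ∂μ := by
  rw [← continuousOn_univ]
  exact continuousOn_integral_of_compact_support isCompact_univ hF.continuousOn
    (fun p y _ hy => absurd (mem_univ y) hy)

/-- Continuity of a dominated parametric integral over a proper metric space with a jointly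
continuous integrand, for an ARBITRARY topological parameter space: the integrand converges
uniformly on compact balls (generalised tube lemma) and the tails are uniformly small by
domination. [folklore] -/
theorem continuousAt_integral_of_continuous_of_dominated [PseudoMetricSpace Y] [ProperSpace Y]
    [MeasurableSpace Y] [OpensMeasurableSpace Y] {μ : Measure Y} [IsFiniteMeasureOnCompacts μ]
    {F : P → Y → ℝ} (hF : Continuous (Function.uncurry F)) {p₀ : P} {b : Y → ℝ}
    (hb : Integrable b μ) (hdom : ∀ᶠ p in 𝓝 p₀, ∀ y, ‖F p y‖ ≤ b y) :
    ContinuousAt (fun p => ∫ y, F p y ∂μ) p₀ := by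
  have hp₀ : ∀ y, ‖F p₀ y‖ ≤ b y := hdom.self_of_nhds
  have hcont : ∀ p, Continuous (F p) := fun p => hF.comp (Continuous.prodMk_right p)
  have hint : ∀ p, (∀ y, ‖F p y‖ ≤ b y) → Integrable (F p) μ := fun p hp =>
    hb.mono' (hcont p).aestronglyMeasurable (Eventually.of_forall hp)
  rcases isEmpty_or_nonempty Y with hY | ⟨⟨y₀⟩⟩
  · have hμ : μ = 0 := Measure.eq_zero_of_isEmpty μ
    simp only [hμ, integral_zero_measure]
    exact continuousAt_const
  rw [Metric.continuousAt_iff']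
  intro ε hε
  -- tails of the dominating function
  have htail : Tendsto (fun n : ℕ => ∫ y in (closedBall y₀ n)ᶜ, b y ∂μ) atTop (𝓝 0) := by
    have h := tendsto_setIntegral_of_antitone (μ := μ) (f := b)
      (s := fun n : ℕ => (closedBall y₀ (n : ℝ))ᶜ)
      (fun n => measurableSet_closedBall.compl)
      (fun m n hmn => compl_subset_compl.2 (closedBall_subset_closedBall (by exact_mod_cast hmn)))
      ⟨0, hb.integrableOn⟩
    have he : (⋂ n : ℕ, (closedBall y₀ (n : ℝ))ᶜ) = ∅ := by
      refine eq_empty_iff_forall_notMem.2 fun y hy => ?_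
      obtain ⟨n, hn⟩ := exists_nat_ge (dist y y₀)
      exact (mem_iInter.1 hy n) (mem_closedBall.2 hn)
    rwa [he, Measure.restrict_empty, integral_zero_measure] at h
  obtain ⟨N, hN⟩ := (htail.eventually (gt_mem_nhds (show (0 : ℝ) < ε / 4 by positivity))).exists
  set K : Set Y := closedBall y₀ (N : ℝ) with hK_def
  have hK : IsCompact K := isCompact_closedBall _ _
  have hKm : MeasurableSet K := measurableSet_closedBall
  have hμK : μ K < ∞ := hK.measure_lt_top
  set δ : ℝ := ε / (4 * (μ.real K + 1)) with hδ_def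
  have hδ : 0 < δ := by positivity
  -- uniform closeness on the compact ball
  have hunif : ∀ᶠ p in 𝓝 p₀, ∀ y ∈ K, dist (F p y) (F p₀ y) < δ := by
    refine hK.eventually_forall_of_forall_eventually fun y _ => ?_
    have hc : Continuous fun z : P × Y => dist (F z.1 z.2) (F p₀ z.2) :=
      hF.dist (hF.comp (continuous_const.prodMk continuous_snd))
    have h0 : dist (F p₀ y) (F p₀ y) < δ := by rw [dist_self]; exact hδ
    exact hc.continuousAt.eventually_lt continuousAt_const h0
  filter_upwards [hdom, hunif] with p hp hpu
  have hIp := hint p hp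
  have hI₀ := hint p₀ hp₀
  have hD : Integrable (fun y => ‖F p y - F p₀ y‖) μ := (hIp.sub hI₀).norm
  rw [dist_eq_norm, ← integral_sub hIp hI₀]
  calc ‖∫ y, F p y - F p₀ y ∂μ‖ ≤ ∫ y, ‖F p y - F p₀ y‖ ∂μ := norm_integral_le_integral_norm _
    _ = (∫ y in K, ‖F p y - F p₀ y‖ ∂μ) + ∫ y in Kᶜ, ‖F p y - F p₀ y‖ ∂μ :=
        (integral_add_compl hKm hD).symm
    _ ≤ (∫ _ in K, δ ∂μ) + ∫ y in Kᶜ, (b y + b y) ∂μ := by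
        refine add_le_add ?_ ?_
        · refine setIntegral_mono_on hD.integrableOn (integrableOn_const hμK.ne) hKm
            fun y hy => le_of_lt ?_
          rw [← dist_eq_norm]
          exact hpu y hy
        · refine setIntegral_mono_on hD.integrableOn (hb.add hb).integrableOn hKm.compl
            fun y _ => ?_
          exact (norm_sub_le _ _).trans (add_le_add (hp y) (hp₀ y))
    _ = δ * μ.real K + 2 * ∫ y in Kᶜ, b y ∂μ := by
        rw [setIntegral_const, smul_eq_mul, mul_comm, integral_add hb.integrableOn hb.integrableOn,
          two_mul]
    _ < ε / 4 + 2 * (ε / 4) := by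
        have h1 : δ * μ.real K ≤ ε / 4 := by
          rw [hδ_def, div_mul_eq_mul_div, div_le_iff₀ (by positivity)]
          nlinarith [measureReal_nonneg (μ := μ) (s := K), hε.le]
        have h2 : ∫ y in Kᶜ, b y ∂μ < ε / 4 := hN
        linarith
    _ ≤ ε := by linarith

end Parametric

/-! ## B. Velocity-side estimates for a Grad cut-off kernel against the Maxwellian -/

section Velocity

variable {E : Type*} [NormedAddCommGroup E] [InnerProductSpace ℝ E]

/-- Conservation of energy makes the Maxwellian a collision invariant:
`M(v') M(v_*') = M(v) M(v_*)`. [folklore] -/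
theorem globalMaxwellian_collide_mul (ω : sphere (0 : E) 1) (p : E × E) :
    globalMaxwellian (collide ω p).1 * globalMaxwellian (collide ω p).2 =
      globalMaxwellian p.1 * globalMaxwellian p.2 := by
  have h := exp_collide_mul_exp_collide 1 ω p
  have e : ∀ u : E, globalMaxwellian u =
      (2 * π) ^ (-(Module.finrank ℝ E : ℝ) / 2) * exp (-(1 / 2) * ‖u‖ ^ 2) := fun u => by
    rw [globalMaxwellian]
    congr 1
    congr 1
    ring
  simp only [e]
  rw [mul_mul_mul_comm, h, ← mul_mul_mul_comm]

/-- `|v'|² ≤ |v|² + |v_*|²` (conservation of energy). [folklore] -/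
theorem norm_sq_collide_fst_le (ω : sphere (0 : E) 1) (p : E × E) :
    ‖(collide ω p).1‖ ^ 2 ≤ ‖p.1‖ ^ 2 + ‖p.2‖ ^ 2 := by
  have h := Literature.MathematicalPhysics.KineticTheory.norm_sq_collide_fst_add_norm_sq_collide_snd ω p
  nlinarith [sq_nonneg ‖(collide ω p).2‖]

/-- The Maxwellian is maximal at the origin. [folklore] -/
theorem globalMaxwellian_le_zero (v : E) : globalMaxwellian v ≤ globalMaxwellian (0 : E) := by
  unfold globalMaxwellian
  refine mul_le_mul_of_nonneg_left (exp_le_exp.2 ?_) (rpow_nonneg (by positivity) _)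
  rw [norm_zero]
  nlinarith [sq_nonneg ‖v‖]

/-- Transfer of the weight `M(u) e^{s(1+|u|²)}` through a collision:
`M(v') e^{s(1+|v'|²)} M(v_*') ≤ M(v) e^{s(1+|v|²)} · M(v_*) e^{s|v_*|²}` for `s ≥ 0`. [folklore] -/
theorem weight_collide_le {s : ℝ} (hs : 0 ≤ s) (ω : sphere (0 : E) 1) (v w : E) :
    globalMaxwellian (collide ω (v, w)).1 * exp (s * (1 + ‖(collide ω (v, w)).1‖ ^ 2)) *
        globalMaxwellian (collide ω (v, w)).2 ≤
      globalMaxwellian v * exp (s * (1 + ‖v‖ ^ 2)) *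
        (globalMaxwellian w * exp (s * ‖w‖ ^ 2)) := by
  have hM := globalMaxwellian_collide_mul ω (v, w)
  have hn := norm_sq_collide_fst_le ω (v, w)
  have hexp : exp (s * (1 + ‖(collide ω (v, w)).1‖ ^ 2)) ≤
      exp (s * (1 + ‖v‖ ^ 2)) * exp (s * ‖w‖ ^ 2) := by
    rw [← exp_add]
    exact exp_le_exp.2 (by nlinarith)
  calc globalMaxwellian (collide ω (v, w)).1 * exp (s * (1 + ‖(collide ω (v, w)).1‖ ^ 2)) *
        globalMaxwellian (collide ω (v, w)).2
      = (globalMaxwellian (collide ω (v, w)).1 * globalMaxwellian (collide ω (v, w)).2) *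
          exp (s * (1 + ‖(collide ω (v, w)).1‖ ^ 2)) := by ring
    _ ≤ (globalMaxwellian (collide ω (v, w)).1 * globalMaxwellian (collide ω (v, w)).2) *
          (exp (s * (1 + ‖v‖ ^ 2)) * exp (s * ‖w‖ ^ 2)) :=
        mul_le_mul_of_nonneg_left hexp
          (mul_nonneg (globalMaxwellian_pos _).le (globalMaxwellian_pos _).le)
    _ = _ := by simp only [hM]; ring

/-- `M(w) e^{|w|²/4}` is again a Gaussian. [folklore] -/
theorem globalMaxwellian_mul_exp_quarter (w : E) :
    globalMaxwellian w * exp (‖w‖ ^ 2 / 4) =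
      (2 * π) ^ (-(Module.finrank ℝ E : ℝ) / 2) * exp (-((1 / 2) / 2) * ‖w‖ ^ 2) := by
  rw [globalMaxwellian, mul_assoc, ← exp_add]
  congr 1
  congr 1
  ring

variable [FiniteDimensional ℝ E] [MeasurableSpace E] [BorelSpace E]

/-- The moment weight `ψ(w) = (1 + |w|) M(w) e^{|w|²/4}` is integrable. [folklore] -/
theorem integrable_one_add_norm_mul_globalMaxwellian_mul_exp :
    Integrable (fun w : E => (1 + ‖w‖) * (globalMaxwellian w * exp (‖w‖ ^ 2 / 4))) := by
  have h := (integrable_one_add_norm_mul_exp (E := E) (β := 1 / 2) (by norm_num)).const_mul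
    ((2 * π) ^ (-(Module.finrank ℝ E : ℝ) / 2))
  refine h.congr (Eventually.of_forall fun w => ?_)
  simp only
  rw [globalMaxwellian_mul_exp_quarter]
  ring

variable {B : E × E → sphere (0 : E) 1 → ℝ}

/-- Pointwise-in-`v_*` bound on the sphere integral of the gain integrand under a weighted bound
`|φ| ≤ N M e^{s(1+|·|²)}`, `0 ≤ s ≤ 1/4`:
`|∫ B φ(v') M(v_*') dω| ≤ |S| K N (1+|v|) M(v) e^{s(1+|v|²)} ψ(v_*)`. [folklore] -/
theorem norm_sphereIntegral_gain_le (hB : IsGradCutoffKernel B) {Kc : ℝ} (hKc0 : 0 ≤ Kc)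
    (hKc : ∀ p ω, B p ω ≤ Kc * (1 + ‖p.1 - p.2‖)) {s N : ℝ} (hs0 : 0 ≤ s) (hs : s ≤ 1 / 4)
    (hN : 0 ≤ N) {φ : E → ℝ}
    (hφ : ∀ u, |φ u| ≤ N * (globalMaxwellian u * exp (s * (1 + ‖u‖ ^ 2)))) (v w : E) :
    ‖∫ ω, B (v, w) ω * (φ (collide ω (v, w)).1 * globalMaxwellian (collide ω (v, w)).2)
        ∂sphereMeasure‖ ≤
      (sphereMeasure : Measure (sphere (0 : E) 1)).real univ *
        (Kc * N * ((1 + ‖v‖) * (globalMaxwellian v * exp (s * (1 + ‖v‖ ^ 2))))) *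
        ((1 + ‖w‖) * (globalMaxwellian w * exp (‖w‖ ^ 2 / 4))) := by
  haveI := isFiniteMeasure_sphereMeasure (E := E)
  set c : ℝ := (Kc * N * ((1 + ‖v‖) * (globalMaxwellian v * exp (s * (1 + ‖v‖ ^ 2))))) *
    ((1 + ‖w‖) * (globalMaxwellian w * exp (‖w‖ ^ 2 / 4))) with hc
  have hpt : ∀ ω : sphere (0 : E) 1,
      ‖B (v, w) ω * (φ (collide ω (v, w)).1 * globalMaxwellian (collide ω (v, w)).2)‖ ≤ c := by
    intro ω
    rw [Real.norm_eq_abs, abs_mul, abs_of_nonneg (hB.nonneg _ _), abs_mul,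
      abs_of_nonneg (globalMaxwellian_pos _).le]
    have h1 : B (v, w) ω ≤ Kc * ((1 + ‖v‖) * (1 + ‖w‖)) :=
      (hKc _ _).trans (mul_le_mul_of_nonneg_left (one_add_norm_sub_le v w) hKc0)
    have h3 := weight_collide_le hs0 ω v w
    have h4 : globalMaxwellian w * exp (s * ‖w‖ ^ 2) ≤ globalMaxwellian w * exp (‖w‖ ^ 2 / 4) := by
      refine mul_le_mul_of_nonneg_left (exp_le_exp.2 ?_) (globalMaxwellian_pos _).le
      nlinarith [sq_nonneg ‖w‖]
    have h2 : |φ (collide ω (v, w)).1| * globalMaxwellian (collide ω (v, w)).2 ≤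
        N * (globalMaxwellian v * exp (s * (1 + ‖v‖ ^ 2)) *
          (globalMaxwellian w * exp (‖w‖ ^ 2 / 4))) := by
      calc |φ (collide ω (v, w)).1| * globalMaxwellian (collide ω (v, w)).2
          ≤ N * (globalMaxwellian (collide ω (v, w)).1 *
              exp (s * (1 + ‖(collide ω (v, w)).1‖ ^ 2))) * globalMaxwellian (collide ω (v, w)).2 :=
            mul_le_mul_of_nonneg_right (hφ _) (globalMaxwellian_pos _).le
        _ = N * (globalMaxwellian (collide ω (v, w)).1 *
              exp (s * (1 + ‖(collide ω (v, w)).1‖ ^ 2)) * globalMaxwellian (collide ω (v, w)).2) := by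
            ring
        _ ≤ N * (globalMaxwellian v * exp (s * (1 + ‖v‖ ^ 2)) *
              (globalMaxwellian w * exp (‖w‖ ^ 2 / 4))) :=
            mul_le_mul_of_nonneg_left (h3.trans (mul_le_mul_of_nonneg_left h4
              (mul_nonneg (globalMaxwellian_pos _).le (exp_pos _).le))) hN
    calc B (v, w) ω * (|φ (collide ω (v, w)).1| * globalMaxwellian (collide ω (v, w)).2)
        ≤ (Kc * ((1 + ‖v‖) * (1 + ‖w‖))) * (N * (globalMaxwellian v * exp (s * (1 + ‖v‖ ^ 2)) *
              (globalMaxwellian w * exp (‖w‖ ^ 2 / 4)))) :=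
          mul_le_mul h1 h2 (mul_nonneg (abs_nonneg _) (globalMaxwellian_pos _).le) (by positivity)
      _ = c := by rw [hc]; ring
  calc ‖∫ ω, B (v, w) ω * (φ (collide ω (v, w)).1 * globalMaxwellian (collide ω (v, w)).2)
        ∂sphereMeasure‖
      ≤ ∫ _ω, c ∂(sphereMeasure : Measure (sphere (0 : E) 1)) :=
        norm_integral_le_of_norm_le (integrable_const c) (Eventually.of_forall hpt)
    _ = (sphereMeasure : Measure (sphere (0 : E) 1)).real univ * c := by
        rw [integral_const, smul_eq_mul]
    _ = _ := by rw [hc]; ring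

/-- Pointwise-in-`v_*` bound on the sphere integral of the loss frequency integrand:
`|∫ B M(v_*) dω| ≤ |S| K (1+|v|) ψ(v_*)`. [folklore] -/
theorem norm_sphereIntegral_loss_le (hB : IsGradCutoffKernel B) {Kc : ℝ} (hKc0 : 0 ≤ Kc)
    (hKc : ∀ p ω, B p ω ≤ Kc * (1 + ‖p.1 - p.2‖)) (v w : E) :
    ‖∫ ω, B (v, w) ω * globalMaxwellian w ∂sphereMeasure‖ ≤
      (sphereMeasure : Measure (sphere (0 : E) 1)).real univ * (Kc * (1 + ‖v‖)) *
        ((1 + ‖w‖) * (globalMaxwellian w * exp (‖w‖ ^ 2 / 4))) := by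
  haveI := isFiniteMeasure_sphereMeasure (E := E)
  set c : ℝ := (Kc * (1 + ‖v‖)) * ((1 + ‖w‖) * (globalMaxwellian w * exp (‖w‖ ^ 2 / 4))) with hc
  have hpt : ∀ ω : sphere (0 : E) 1, ‖B (v, w) ω * globalMaxwellian w‖ ≤ c := by
    intro ω
    rw [Real.norm_eq_abs, abs_mul, abs_of_nonneg (hB.nonneg _ _),
      abs_of_nonneg (globalMaxwellian_pos _).le]
    have h1 : B (v, w) ω ≤ Kc * ((1 + ‖v‖) * (1 + ‖w‖)) :=
      (hKc _ _).trans (mul_le_mul_of_nonneg_left (one_add_norm_sub_le v w) hKc0)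
    have h2 : globalMaxwellian w ≤ globalMaxwellian w * exp (‖w‖ ^ 2 / 4) :=
      le_mul_of_one_le_right (globalMaxwellian_pos _).le (one_le_exp (by positivity))
    calc B (v, w) ω * globalMaxwellian w
        ≤ (Kc * ((1 + ‖v‖) * (1 + ‖w‖))) * (globalMaxwellian w * exp (‖w‖ ^ 2 / 4)) :=
          mul_le_mul h1 h2 (globalMaxwellian_pos _).le (by positivity)
      _ = c := by rw [hc]; ring
  calc ‖∫ ω, B (v, w) ω * globalMaxwellian w ∂sphereMeasure‖
      ≤ ∫ _ω, c ∂(sphereMeasure : Measure (sphere (0 : E) 1)) :=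
        norm_integral_le_of_norm_le (integrable_const c) (Eventually.of_forall hpt)
    _ = (sphereMeasure : Measure (sphere (0 : E) 1)).real univ * c := by
        rw [integral_const, smul_eq_mul]
    _ = _ := by rw [hc]; ring

/-- **The kernel constants.** For a Grad cut-off kernel there are `κ ≥ 0` and an integrable
`b ≥ 0` on velocity space such that: the loss frequency `ν(v) = ∫∫ B M(v_*)` is at most
`κ (1 + |v|)` with sphere integrals dominated by `(1+|v|) b(v_*)`; and for every `φ` with
`|φ| ≤ N M e^{s(1+|·|²)}`, `0 ≤ s ≤ 1/4`, the gain term `∫∫ B φ(v') M(v_*')` has sphere integrals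
dominated by `N (1+|v|) M(v) e^{s(1+|v|²)} b(v_*)` and is at most `N κ (1+|v|) M(v) e^{s(1+|v|²)}`
(the velocity-weighted `L^∞` estimates behind the maximum principle; the Gaussian moment of
order `e^{|v_*|²/4}` is what limits `s ≤ 1/4`). [folklore] -/
theorem exists_kernel_bounds (hB : IsGradCutoffKernel B) :
    ∃ κ : ℝ, 0 ≤ κ ∧ ∃ b : E → ℝ, Integrable b ∧ (∀ w, 0 ≤ b w) ∧
      (∀ v w, ‖∫ ω, B (v, w) ω * globalMaxwellian w ∂sphereMeasure‖ ≤ (1 + ‖v‖) * b w) ∧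
      (∀ v, ∫ w, ∫ ω, B (v, w) ω * globalMaxwellian w ∂sphereMeasure ≤ κ * (1 + ‖v‖)) ∧
      (∀ (s N : ℝ), 0 ≤ s → s ≤ 1 / 4 → 0 ≤ N → ∀ φ : E → ℝ,
        (∀ u, |φ u| ≤ N * (globalMaxwellian u * exp (s * (1 + ‖u‖ ^ 2)))) → ∀ v,
        (∀ w, ‖∫ ω, B (v, w) ω * (φ (collide ω (v, w)).1 * globalMaxwellian (collide ω (v, w)).2)
            ∂sphereMeasure‖ ≤
            N * ((1 + ‖v‖) * (globalMaxwellian v * exp (s * (1 + ‖v‖ ^ 2)))) * b w) ∧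
        ∫ w, ‖∫ ω, B (v, w) ω * (φ (collide ω (v, w)).1 * globalMaxwellian (collide ω (v, w)).2)
            ∂sphereMeasure‖ ≤
          N * κ * ((1 + ‖v‖) * (globalMaxwellian v * exp (s * (1 + ‖v‖ ^ 2))))) ∧
      (∀ C : ℝ, 0 ≤ C → ∀ φ : E → ℝ, (∀ u, |φ u| ≤ C * globalMaxwellian u) → ∀ v,
        (∀ w, ‖∫ ω, B (v, w) ω * (φ (collide ω (v, w)).1 * globalMaxwellian (collide ω (v, w)).2)
            ∂sphereMeasure‖ ≤ C * ((1 + ‖v‖) * globalMaxwellian v) * b w) ∧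
        ∫ w, ‖∫ ω, B (v, w) ω * (φ (collide ω (v, w)).1 * globalMaxwellian (collide ω (v, w)).2)
            ∂sphereMeasure‖ ≤ C * κ * ((1 + ‖v‖) * globalMaxwellian v)) := by
  obtain ⟨Kc, hKc0, hKc⟩ := hB.exists_bound_nonneg
  set S : ℝ := (sphereMeasure : Measure (sphere (0 : E) 1)).real univ with hS
  have hS0 : 0 ≤ S := measureReal_nonneg
  set ψ : E → ℝ := fun w => (1 + ‖w‖) * (globalMaxwellian w * exp (‖w‖ ^ 2 / 4)) with hψ
  have hψi : Integrable ψ := integrable_one_add_norm_mul_globalMaxwellian_mul_exp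
  have hψ0 : ∀ w, 0 ≤ ψ w := fun w =>
    mul_nonneg (by positivity) (mul_nonneg (globalMaxwellian_pos _).le (exp_pos _).le)
  set b : E → ℝ := fun w => S * Kc * ψ w with hb
  have hbi : Integrable b := hψi.const_mul _
  have hI0 : 0 ≤ ∫ w, ψ w := integral_nonneg hψ0
  -- the weighted gain statement
  have hgain : ∀ (s N : ℝ), 0 ≤ s → s ≤ 1 / 4 → 0 ≤ N → ∀ φ : E → ℝ,
      (∀ u, |φ u| ≤ N * (globalMaxwellian u * exp (s * (1 + ‖u‖ ^ 2)))) → ∀ v,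
      (∀ w, ‖∫ ω, B (v, w) ω * (φ (collide ω (v, w)).1 * globalMaxwellian (collide ω (v, w)).2)
          ∂sphereMeasure‖ ≤
          N * ((1 + ‖v‖) * (globalMaxwellian v * exp (s * (1 + ‖v‖ ^ 2)))) * b w) ∧
      ∫ w, ‖∫ ω, B (v, w) ω * (φ (collide ω (v, w)).1 * globalMaxwellian (collide ω (v, w)).2)
          ∂sphereMeasure‖ ≤
        N * (S * Kc * ∫ w, ψ w) * ((1 + ‖v‖) * (globalMaxwellian v * exp (s * (1 + ‖v‖ ^ 2)))) := by
    intro s N hs0 hs hN φ hφ v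
    have hpt : ∀ w, ‖∫ ω, B (v, w) ω * (φ (collide ω (v, w)).1 *
        globalMaxwellian (collide ω (v, w)).2) ∂sphereMeasure‖ ≤
        N * ((1 + ‖v‖) * (globalMaxwellian v * exp (s * (1 + ‖v‖ ^ 2)))) * b w := by
      intro w
      refine (norm_sphereIntegral_gain_le hB hKc0 hKc hs0 hs hN hφ v w).trans (le_of_eq ?_)
      rw [hb]
      ring
    refine ⟨hpt, ?_⟩
    calc ∫ w, ‖∫ ω, B (v, w) ω * (φ (collide ω (v, w)).1 *
            globalMaxwellian (collide ω (v, w)).2) ∂sphereMeasure‖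
        ≤ ∫ w, N * ((1 + ‖v‖) * (globalMaxwellian v * exp (s * (1 + ‖v‖ ^ 2)))) * b w :=
          integral_mono_of_nonneg (Eventually.of_forall fun _ => norm_nonneg _) (hbi.const_mul _)
            (Eventually.of_forall hpt)
      _ = _ := by
          rw [integral_const_mul, hb]
          simp only
          rw [integral_const_mul]
          ring
  refine ⟨S * Kc * ∫ w, ψ w, by positivity, b, hbi, fun w => mul_nonneg (by positivity) (hψ0 w),
    ?_, ?_, hgain, ?_⟩
  · intro v w
    refine (norm_sphereIntegral_loss_le hB hKc0 hKc v w).trans (le_of_eq ?_)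
    rw [hb]
    ring
  · intro v
    have hpt : ∀ w, ‖∫ ω, B (v, w) ω * globalMaxwellian w ∂sphereMeasure‖ ≤ (1 + ‖v‖) * b w := by
      intro w
      refine (norm_sphereIntegral_loss_le hB hKc0 hKc v w).trans (le_of_eq ?_)
      rw [hb]
      ring
    calc ∫ w, ∫ ω, B (v, w) ω * globalMaxwellian w ∂sphereMeasure
        ≤ ‖∫ w, ∫ ω, B (v, w) ω * globalMaxwellian w ∂sphereMeasure‖ := le_norm_self _
      _ ≤ ∫ w, (1 + ‖v‖) * b w := norm_integral_le_of_norm_le (hbi.const_mul _)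
          (Eventually.of_forall hpt)
      _ = _ := by
          rw [integral_const_mul, hb]
          simp only
          rw [integral_const_mul]
          ring
  · intro C hC φ hφ v
    have hφ' : ∀ u, |φ u| ≤ C * (globalMaxwellian u * exp (0 * (1 + ‖u‖ ^ 2))) := fun u => by
      rw [zero_mul, exp_zero, mul_one]
      exact hφ u
    have h := hgain 0 C le_rfl (by norm_num) hC φ hφ' v
    simp only [zero_mul, exp_zero, mul_one] at h
    exact h

end Velocity

/-! ## B'. Gain and loss operators against the Maxwellian: integrability, splitting, continuity,
dominated convergence -/

section VelocityOps

variable {E : Type*} [NormedAddCommGroup E] [InnerProductSpace ℝ E] [MeasurableSpace E]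
  {B : E × E → sphere (0 : E) 1 → ℝ}

/-- Pointwise bound on the gain integrand for `|φ| ≤ C M`. [folklore] -/
theorem norm_gainIntegrand_le (hB : IsGradCutoffKernel B) {Kc : ℝ} (hKc0 : 0 ≤ Kc)
    (hKc : ∀ p ω, B p ω ≤ Kc * (1 + ‖p.1 - p.2‖)) {C : ℝ} {φ : E → ℝ}
    (hφ : ∀ u, |φ u| ≤ C * globalMaxwellian u) (v w : E) (ω : sphere (0 : E) 1) :
    ‖B (v, w) ω * (φ (collide ω (v, w)).1 * globalMaxwellian (collide ω (v, w)).2)‖ ≤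
      Kc * ((1 + ‖v‖) * (1 + ‖w‖)) * (C * (globalMaxwellian v * globalMaxwellian w)) := by
  rw [Real.norm_eq_abs, abs_mul, abs_of_nonneg (hB.nonneg _ _), abs_mul,
    abs_of_nonneg (globalMaxwellian_pos _).le]
  have h1 : B (v, w) ω ≤ Kc * ((1 + ‖v‖) * (1 + ‖w‖)) :=
    (hKc _ _).trans (mul_le_mul_of_nonneg_left (one_add_norm_sub_le v w) hKc0)
  have h2 : |φ (collide ω (v, w)).1| * globalMaxwellian (collide ω (v, w)).2 ≤
      C * (globalMaxwellian v * globalMaxwellian w) := by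
    calc |φ (collide ω (v, w)).1| * globalMaxwellian (collide ω (v, w)).2
        ≤ C * globalMaxwellian (collide ω (v, w)).1 * globalMaxwellian (collide ω (v, w)).2 :=
          mul_le_mul_of_nonneg_right (hφ _) (globalMaxwellian_pos _).le
      _ = C * (globalMaxwellian v * globalMaxwellian w) := by
          rw [mul_assoc, globalMaxwellian_collide_mul]
  exact mul_le_mul h1 h2 (mul_nonneg (abs_nonneg _) (globalMaxwellian_pos _).le) (by positivity)

/-- Pointwise bound on the loss integrand for `|φ| ≤ C M`. [folklore] -/
theorem norm_lossIntegrand_le (hB : IsGradCutoffKernel B) {Kc : ℝ} (hKc0 : 0 ≤ Kc)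
    (hKc : ∀ p ω, B p ω ≤ Kc * (1 + ‖p.1 - p.2‖)) {C : ℝ} {φ : E → ℝ}
    (hφ : ∀ u, |φ u| ≤ C * globalMaxwellian u) (v w : E) (ω : sphere (0 : E) 1) :
    ‖B (v, w) ω * (φ v * globalMaxwellian w)‖ ≤
      Kc * ((1 + ‖v‖) * (1 + ‖w‖)) * (C * (globalMaxwellian v * globalMaxwellian w)) := by
  rw [Real.norm_eq_abs, abs_mul, abs_of_nonneg (hB.nonneg _ _), abs_mul,
    abs_of_nonneg (globalMaxwellian_pos _).le]
  have h1 : B (v, w) ω ≤ Kc * ((1 + ‖v‖) * (1 + ‖w‖)) :=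
    (hKc _ _).trans (mul_le_mul_of_nonneg_left (one_add_norm_sub_le v w) hKc0)
  have h2 : |φ v| * globalMaxwellian w ≤ C * (globalMaxwellian v * globalMaxwellian w) := by
    calc |φ v| * globalMaxwellian w ≤ C * globalMaxwellian v * globalMaxwellian w :=
          mul_le_mul_of_nonneg_right (hφ _) (globalMaxwellian_pos _).le
      _ = _ := by ring
  exact mul_le_mul h1 h2 (mul_nonneg (abs_nonneg _) (globalMaxwellian_pos _).le) (by positivity)

/-- Joint measurability in `(v_*, ω)` of the loss integrand against `M`. [folklore] -/
theorem measurable_lossSlice [OpensMeasurableSpace E]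
    (hBm : Measurable (Function.uncurry B)) (c : ℝ) (v : E) :
    Measurable fun q : E × sphere (0 : E) 1 => B (v, q.1) q.2 * (c * globalMaxwellian q.1) := by
  have hr : Measurable fun q : E × sphere (0 : E) 1 => ((v, q.1), q.2) :=
    (measurable_const.prodMk measurable_fst).prodMk measurable_snd
  exact (hBm.comp hr).mul ((continuous_globalMaxwellian.measurable.comp measurable_fst).const_mul c)

variable [FiniteDimensional ℝ E] [BorelSpace E]

/-- The loss frequency `ν(v) = ∫∫ B(v, v_*, ω) M(v_*) dω dv_*` is `lossWith B 1 M v`. [folklore] -/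
theorem lossWith_one_globalMaxwellian (B : E × E → sphere (0 : E) 1 → ℝ) (v : E) :
    lossWith B 1 globalMaxwellian v = ∫ w, ∫ ω, B (v, w) ω * globalMaxwellian w ∂sphereMeasure := by
  simp [lossWith]

/-- The loss term factorises: `Q⁻_B(φ, M)(v) = φ(v) ν(v)` (no integrability needed). [folklore] -/
theorem lossWith_globalMaxwellian_eq_mul (B : E × E → sphere (0 : E) 1 → ℝ) (φ : E → ℝ) (v : E) :
    lossWith B φ globalMaxwellian v = φ v * lossWith B 1 globalMaxwellian v := by
  simp only [lossWith, Pi.one_apply, one_mul]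
  rw [← integral_const_mul]
  congr 1
  funext w
  rw [← integral_const_mul]
  congr 1
  funext ω
  ring

/-- The loss frequency is nonnegative. [folklore] -/
theorem lossWith_one_globalMaxwellian_nonneg (hB : IsGradCutoffKernel B) (v : E) :
    0 ≤ lossWith B 1 globalMaxwellian v := by
  rw [lossWith_one_globalMaxwellian]
  exact integral_nonneg fun w => integral_nonneg fun ω =>
    mul_nonneg (hB.nonneg _ _) (globalMaxwellian_pos _).le

/-- Joint measurability in `(v_*, ω)` of the gain integrand against `M`. [folklore] -/
theorem measurable_gainSlice (hBm : Measurable (Function.uncurry B)) {φ : E → ℝ}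
    (hφ : Measurable φ) (v : E) :
    Measurable fun q : E × sphere (0 : E) 1 =>
      B (v, q.1) q.2 * (φ (collide q.2 (v, q.1)).1 * globalMaxwellian (collide q.2 (v, q.1)).2) := by
  have hr : Measurable fun q : E × sphere (0 : E) 1 => ((v, q.1), q.2) :=
    (measurable_const.prodMk measurable_fst).prodMk measurable_snd
  have hc : Continuous fun q : E × sphere (0 : E) 1 => collide q.2 (v, q.1) :=
    continuous_collide_uncurry.comp ((continuous_const.prodMk continuous_fst).prodMk continuous_snd)
  exact (hBm.comp hr).mul ((hφ.comp hc.fst.measurable).mul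
    (continuous_globalMaxwellian.measurable.comp hc.snd.measurable))

/-- The sphere integrand of the gain term is integrable for measurable `|φ| ≤ C M`. [folklore] -/
theorem integrable_gainSlice_sphere (hB : IsGradCutoffKernel B) {φ : E → ℝ} (hφm : Measurable φ)
    {C : ℝ} (hφ : ∀ u, |φ u| ≤ C * globalMaxwellian u) (v w : E) :
    Integrable (fun ω => B (v, w) ω *
      (φ (collide ω (v, w)).1 * globalMaxwellian (collide ω (v, w)).2)) sphereMeasure := by
  haveI := isFiniteMeasure_sphereMeasure (E := E)
  obtain ⟨Kc, hKc0, hKc⟩ := hB.exists_bound_nonneg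
  exact (integrable_const _).mono'
    ((measurable_gainSlice hB.measurable hφm v).comp measurable_prodMk_left).aestronglyMeasurable
    (Eventually.of_forall fun ω => norm_gainIntegrand_le hB hKc0 hKc hφ v w ω)

/-- The sphere integrand of the loss term is integrable for `|φ| ≤ C M`. [folklore] -/
theorem integrable_lossSlice_sphere (hB : IsGradCutoffKernel B) {φ : E → ℝ}
    {C : ℝ} (hφ : ∀ u, |φ u| ≤ C * globalMaxwellian u) (v w : E) :
    Integrable (fun ω => B (v, w) ω * (φ v * globalMaxwellian w)) sphereMeasure := by
  haveI := isFiniteMeasure_sphereMeasure (E := E)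
  obtain ⟨Kc, hKc0, hKc⟩ := hB.exists_bound_nonneg
  exact (integrable_const _).mono'
    ((measurable_lossSlice hB.measurable (φ v) v).comp measurable_prodMk_left).aestronglyMeasurable
    (Eventually.of_forall fun ω => norm_lossIntegrand_le hB hKc0 hKc hφ v w ω)

/-- The `v_*`-integrand of the gain term (a sphere integral) is integrable for measurable
`|φ| ≤ C M`. [folklore] -/
theorem integrable_gainSlice (hB : IsGradCutoffKernel B) {φ : E → ℝ} (hφm : Measurable φ)
    {C : ℝ} (hC : 0 ≤ C) (hφ : ∀ u, |φ u| ≤ C * globalMaxwellian u) (v : E) :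
    Integrable fun w => ∫ ω, B (v, w) ω *
      (φ (collide ω (v, w)).1 * globalMaxwellian (collide ω (v, w)).2) ∂sphereMeasure := by
  haveI := isFiniteMeasure_sphereMeasure (E := E)
  obtain ⟨κ, -, b, hbi, -, -, -, -, hgainC⟩ := exists_kernel_bounds hB
  have hsm := (measurable_gainSlice hB.measurable hφm v).stronglyMeasurable.integral_prod_right'
    (ν := (sphereMeasure : Measure (sphere (0 : E) 1)))
  exact (hbi.const_mul (C * ((1 + ‖v‖) * globalMaxwellian v))).mono' hsm.aestronglyMeasurable
    (Eventually.of_forall fun w => (hgainC C hC φ hφ v).1 w)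

/-- The `v_*`-integrand of the loss frequency is integrable. [folklore] -/
theorem integrable_lossSlice (hB : IsGradCutoffKernel B) (c : ℝ) (v : E) :
    Integrable fun w => ∫ ω, B (v, w) ω * (c * globalMaxwellian w) ∂sphereMeasure := by
  haveI := isFiniteMeasure_sphereMeasure (E := E)
  obtain ⟨κ, -, b, hbi, -, hlossb, -, -, -⟩ := exists_kernel_bounds hB
  have hsm := (measurable_lossSlice hB.measurable c v).stronglyMeasurable.integral_prod_right'
    (ν := (sphereMeasure : Measure (sphere (0 : E) 1)))
  refine (hbi.const_mul (|c| * (1 + ‖v‖))).mono' hsm.aestronglyMeasurable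
    (Eventually.of_forall fun w => ?_)
  have h : ∫ ω, B (v, w) ω * (c * globalMaxwellian w) ∂sphereMeasure =
      c * ∫ ω, B (v, w) ω * globalMaxwellian w ∂sphereMeasure := by
    rw [← integral_const_mul]
    congr 1
    funext ω
    ring
  rw [h, norm_mul, Real.norm_eq_abs, mul_assoc]
  exact mul_le_mul_of_nonneg_left (hlossb v w) (abs_nonneg c)

/-- **Gain/loss splitting of the linear collision term** for measurable `|φ| ≤ C M`:
`Q_B(φ, M)(v) = ∫∫ B φ(v') M(v_*') − φ(v) ν(v)`. [folklore] -/
theorem collisionOpWith_globalMaxwellian_eq (hB : IsGradCutoffKernel B) {φ : E → ℝ}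
    (hφm : Measurable φ) {C : ℝ} (hC : 0 ≤ C) (hφ : ∀ u, |φ u| ≤ C * globalMaxwellian u) (v : E) :
    collisionOpWith B φ globalMaxwellian v =
      gainWith B φ globalMaxwellian v - φ v * lossWith B 1 globalMaxwellian v := by
  rw [← lossWith_globalMaxwellian_eq_mul]
  simp only [collisionOpWith, gainWith, lossWith]
  have hinner : ∀ w, ∫ ω, B (v, w) ω * (φ (collide ω (v, w)).1 *
      globalMaxwellian (collide ω (v, w)).2 - φ v * globalMaxwellian w) ∂sphereMeasure =
      (∫ ω, B (v, w) ω * (φ (collide ω (v, w)).1 * globalMaxwellian (collide ω (v, w)).2)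
        ∂sphereMeasure) - ∫ ω, B (v, w) ω * (φ v * globalMaxwellian w) ∂sphereMeasure := by
    intro w
    rw [← integral_sub (integrable_gainSlice_sphere hB hφm hφ v w)
      (integrable_lossSlice_sphere hB hφ v w)]
    congr 1
    funext ω
    ring
  rw [integral_congr_ae (Eventually.of_forall hinner)]
  have hl : Integrable fun w => ∫ ω, B (v, w) ω * (φ v * globalMaxwellian w) ∂sphereMeasure :=
    integrable_lossSlice hB (φ v) v
  exact integral_sub (integrable_gainSlice hB hφm hC hφ v) hl

/-- Additivity of the gain term in the density, for measurable Maxwellian-bounded densities.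
[folklore] -/
theorem gainWith_sub_globalMaxwellian (hB : IsGradCutoffKernel B) {φ₁ φ₂ : E → ℝ}
    (h₁m : Measurable φ₁) (h₂m : Measurable φ₂) {C : ℝ} (hC : 0 ≤ C)
    (h₁ : ∀ u, |φ₁ u| ≤ C * globalMaxwellian u) (h₂ : ∀ u, |φ₂ u| ≤ C * globalMaxwellian u)
    (v : E) :
    gainWith B φ₁ globalMaxwellian v - gainWith B φ₂ globalMaxwellian v =
      gainWith B (φ₁ - φ₂) globalMaxwellian v := by
  simp only [gainWith, Pi.sub_apply]
  rw [← integral_sub (integrable_gainSlice hB h₁m hC h₁ v) (integrable_gainSlice hB h₂m hC h₂ v)]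
  refine integral_congr_ae (Eventually.of_forall fun w => ?_)
  simp only
  rw [← integral_sub (integrable_gainSlice_sphere hB h₁m h₁ v w)
    (integrable_gainSlice_sphere hB h₂m h₂ v w)]
  congr 1
  funext ω
  ring

/-- `IsFiniteMeasureOnCompacts` for the sphere measure (a theorem, used via `haveI`). [folklore] -/
theorem isFiniteMeasureOnCompacts_sphereMeasure :
    IsFiniteMeasureOnCompacts (sphereMeasure : Measure (sphere (0 : E) 1)) := by
  haveI := isFiniteMeasure_sphereMeasure (E := E)
  exact ⟨fun K _ => measure_lt_top _ _⟩

/-- **Continuity of the loss frequency** `ν(v) = ∫∫ B M(v_*)` for a continuous Grad cut-off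
kernel. [folklore] -/
theorem continuous_lossWith_one_globalMaxwellian (hB : IsGradCutoffKernel B)
    (hBc : Continuous (Function.uncurry B)) :
    Continuous fun v => lossWith B 1 globalMaxwellian v := by
  obtain ⟨κ, -, b, hbi, hb0, hlossb, -, -, -⟩ := exists_kernel_bounds hB
  haveI := isFiniteMeasureOnCompacts_sphereMeasure (E := E)
  have hF : Continuous fun q : (E × E) × sphere (0 : E) 1 => B q.1 q.2 * globalMaxwellian q.1.2 :=
    hBc.mul (continuous_globalMaxwellian.comp continuous_fst.snd)
  have hinner : Continuous fun p : E × E => ∫ ω, B p ω * globalMaxwellian p.2 ∂sphereMeasure :=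
    continuous_integral_of_continuous_uncurry (P := E × E)
      (F := fun p ω => B p ω * globalMaxwellian p.2) hF
  simp only [lossWith_one_globalMaxwellian]
  refine continuous_iff_continuousAt.2 fun v₀ => ?_
  refine continuousAt_integral_of_continuous_of_dominated
    (F := fun v w => ∫ ω, B (v, w) ω * globalMaxwellian w ∂sphereMeasure)
    (b := fun w => (2 + ‖v₀‖) * b w) (hinner.comp (continuous_fst.prodMk continuous_snd))
    (hbi.const_mul _) ?_
  have hball : ∀ᶠ v in 𝓝 v₀, dist v v₀ < 1 := Metric.ball_mem_nhds v₀ one_pos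
  filter_upwards [hball] with v hv w
  refine (hlossb v w).trans (mul_le_mul_of_nonneg_right ?_ (hb0 w))
  have : ‖v‖ ≤ ‖v - v₀‖ + ‖v₀‖ := norm_le_norm_sub_add v v₀
  rw [dist_eq_norm] at hv
  linarith

/-- **Continuity of the gain term** `(p, v) ↦ ∫∫ B(v, v_*, ω) Φ(p, v') M(v_*')` for a jointly
continuous, Maxwellian-bounded family of densities over an ARBITRARY topological parameter
space. [folklore] -/
theorem continuous_gainWith_param {P : Type*} [TopologicalSpace P] (hB : IsGradCutoffKernel B)
    (hBc : Continuous (Function.uncurry B)) {Φ : P → E → ℝ}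
    (hΦc : Continuous fun q : P × E => Φ q.1 q.2) {C : ℝ} (hC : 0 ≤ C)
    (hΦ : ∀ p u, |Φ p u| ≤ C * globalMaxwellian u) :
    Continuous fun q : P × E => gainWith B (Φ q.1) globalMaxwellian q.2 := by
  obtain ⟨κ, -, b, hbi, hb0, -, -, -, hgainC⟩ := exists_kernel_bounds hB
  haveI := isFiniteMeasureOnCompacts_sphereMeasure (E := E)
  have hcol : Continuous fun z : ((P × E) × E) × sphere (0 : E) 1 =>
      collide z.2 (z.1.1.2, z.1.2) :=
    continuous_collide_uncurry.comp
      ((continuous_fst.fst.snd.prodMk continuous_fst.snd).prodMk continuous_snd)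
  have hBz : Continuous fun z : ((P × E) × E) × sphere (0 : E) 1 => B (z.1.1.2, z.1.2) z.2 :=
    hBc.comp ((continuous_fst.fst.snd.prodMk continuous_fst.snd).prodMk continuous_snd)
  have hΦz : Continuous fun z : ((P × E) × E) × sphere (0 : E) 1 =>
      Φ z.1.1.1 (collide z.2 (z.1.1.2, z.1.2)).1 :=
    hΦc.comp (continuous_fst.fst.fst.prodMk hcol.fst)
  have hI : Continuous fun r : (P × E) × E => ∫ ω, B (r.1.2, r.2) ω *
      (Φ r.1.1 (collide ω (r.1.2, r.2)).1 * globalMaxwellian (collide ω (r.1.2, r.2)).2)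
        ∂sphereMeasure :=
    continuous_integral_of_continuous_uncurry (P := (P × E) × E)
      (F := fun r ω => B (r.1.2, r.2) ω *
        (Φ r.1.1 (collide ω (r.1.2, r.2)).1 * globalMaxwellian (collide ω (r.1.2, r.2)).2))
      (hBz.mul (hΦz.mul (continuous_globalMaxwellian.comp hcol.snd)))
  simp only [gainWith]
  refine continuous_iff_continuousAt.2 fun q₀ => ?_
  refine continuousAt_integral_of_continuous_of_dominated
    (F := fun (q : P × E) w => ∫ ω, B (q.2, w) ω *
      (Φ q.1 (collide ω (q.2, w)).1 * globalMaxwellian (collide ω (q.2, w)).2) ∂sphereMeasure)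
    (b := fun w => C * ((2 + ‖q₀.2‖) * globalMaxwellian (0 : E)) * b w) hI (hbi.const_mul _) ?_
  have hball : ∀ᶠ q : P × E in 𝓝 q₀, dist q.2 q₀.2 < 1 :=
    (continuous_snd.tendsto q₀).eventually (Metric.ball_mem_nhds q₀.2 one_pos)
  filter_upwards [hball] with q hq w
  refine ((hgainC C hC (Φ q.1) (hΦ q.1) q.2).1 w).trans ?_
  refine mul_le_mul_of_nonneg_right (mul_le_mul_of_nonneg_left ?_ hC) (hb0 w)
  have h1 : ‖q.2‖ ≤ ‖q.2 - q₀.2‖ + ‖q₀.2‖ := norm_le_norm_sub_add _ _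
  rw [dist_eq_norm] at hq
  exact mul_le_mul (by linarith) (globalMaxwellian_le_zero _) (globalMaxwellian_pos _).le
    (by positivity)

/-- **Dominated convergence for the gain term**: if measurable `φₙ → φ` pointwise with
`|φₙ| ≤ C M`, then `∫∫ B φₙ(v') M(v_*') → ∫∫ B φ(v') M(v_*')`. [folklore] -/
theorem tendsto_gainWith_globalMaxwellian (hB : IsGradCutoffKernel B) {φ : ℕ → E → ℝ}
    {φ' : E → ℝ} (hφm : ∀ n, Measurable (φ n)) {C : ℝ} (hC : 0 ≤ C)
    (hφ : ∀ n u, |φ n u| ≤ C * globalMaxwellian u)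
    (hlim : ∀ u, Tendsto (fun n => φ n u) atTop (𝓝 (φ' u))) (v : E) :
    Tendsto (fun n => gainWith B (φ n) globalMaxwellian v) atTop
      (𝓝 (gainWith B φ' globalMaxwellian v)) := by
  obtain ⟨κ, -, b, hbi, hb0, -, -, -, hgainC⟩ := exists_kernel_bounds hB
  haveI := isFiniteMeasure_sphereMeasure (E := E)
  obtain ⟨Kc, hKc0, hKc⟩ := hB.exists_bound_nonneg
  simp only [gainWith]
  have hinner : ∀ w, Tendsto (fun n => ∫ ω, B (v, w) ω *
      (φ n (collide ω (v, w)).1 * globalMaxwellian (collide ω (v, w)).2) ∂sphereMeasure) atTop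
      (𝓝 (∫ ω, B (v, w) ω * (φ' (collide ω (v, w)).1 * globalMaxwellian (collide ω (v, w)).2)
        ∂sphereMeasure)) := by
    intro w
    refine tendsto_integral_of_dominated_convergence
      (fun _ => Kc * ((1 + ‖v‖) * (1 + ‖w‖)) * (C * (globalMaxwellian v * globalMaxwellian w)))
      (fun n => ((measurable_gainSlice hB.measurable (hφm n) v).comp
        measurable_prodMk_left).aestronglyMeasurable)
      (integrable_const _) (fun n => Eventually.of_forall fun ω =>
        norm_gainIntegrand_le hB hKc0 hKc (hφ n) v w ω) (Eventually.of_forall fun ω => ?_)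
    exact (((hlim _).mul_const _).const_mul _)
  exact tendsto_integral_of_dominated_convergence (fun w => C * ((1 + ‖v‖) * globalMaxwellian v) * b w)
    (fun n => ((measurable_gainSlice hB.measurable (hφm n) v).stronglyMeasurable.integral_prod_right'
      (ν := (sphereMeasure : Measure (sphere (0 : E) 1)))).aestronglyMeasurable)
    (hbi.const_mul _) (fun n => Eventually.of_forall fun w => (hgainC C hC (φ n) (hφ n) v).1 w)
    (Eventually.of_forall hinner)

end VelocityOps

section VelocityOps2

variable {E : Type*} [NormedAddCommGroup E] [InnerProductSpace ℝ E] [FiniteDimensional ℝ E]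
  [MeasurableSpace E] [BorelSpace E] {B : E × E → sphere (0 : E) 1 → ℝ}

/-- The gain term vanishes on the zero density. [folklore] -/
theorem gainWith_zero_globalMaxwellian (B : E × E → sphere (0 : E) 1 → ℝ) (v : E) :
    gainWith B 0 globalMaxwellian v = 0 := by
  simp [gainWith]

/-- The gain term of the Maxwellian itself: `∫∫ B (C M)(v') M(v_*') = C M(v) ν(v)`. [folklore] -/
theorem gainWith_const_mul_globalMaxwellian (B : E × E → sphere (0 : E) 1 → ℝ) (C : ℝ) (v : E) :
    gainWith B (fun u => C * globalMaxwellian u) globalMaxwellian v =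
      C * globalMaxwellian v * lossWith B 1 globalMaxwellian v := by
  rw [lossWith_one_globalMaxwellian, gainWith, ← integral_const_mul]
  congr 1
  funext w
  rw [← integral_const_mul]
  congr 1
  funext ω
  have h := globalMaxwellian_collide_mul ω (v, w)
  calc B (v, w) ω * (C * globalMaxwellian (collide ω (v, w)).1 * globalMaxwellian (collide ω (v, w)).2)
      = B (v, w) ω * (C * (globalMaxwellian (collide ω (v, w)).1 *
          globalMaxwellian (collide ω (v, w)).2)) := by ring
    _ = B (v, w) ω * (C * (globalMaxwellian v * globalMaxwellian w)) := by rw [h]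
    _ = _ := by ring

/-- Monotonicity of the gain term in the density (positivity of the kernel). [folklore] -/
theorem gainWith_mono_globalMaxwellian (hB : IsGradCutoffKernel B) {φ φ' : E → ℝ}
    (hφm : Measurable φ) (hφ'm : Measurable φ') {C : ℝ} (hC : 0 ≤ C)
    (hφb : ∀ u, |φ u| ≤ C * globalMaxwellian u) (hφ'b : ∀ u, |φ' u| ≤ C * globalMaxwellian u)
    (hle : ∀ u, φ u ≤ φ' u) (v : E) :
    gainWith B φ globalMaxwellian v ≤ gainWith B φ' globalMaxwellian v := by
  simp only [gainWith]
  refine integral_mono (integrable_gainSlice hB hφm hC hφb v) (integrable_gainSlice hB hφ'm hC hφ'b v)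
    fun w => ?_
  refine integral_mono (integrable_gainSlice_sphere hB hφm hφb v w)
    (integrable_gainSlice_sphere hB hφ'm hφ'b v w) fun ω => ?_
  exact mul_le_mul_of_nonneg_left (mul_le_mul_of_nonneg_right (hle _) (globalMaxwellian_pos _).le)
    (hB.nonneg _ _)

/-- Additivity of the gain term in the density, for measurable Maxwellian-bounded densities.
[folklore] -/
theorem gainWith_add_globalMaxwellian (hB : IsGradCutoffKernel B) {φ₁ φ₂ : E → ℝ}
    (h₁m : Measurable φ₁) (h₂m : Measurable φ₂) {C : ℝ} (hC : 0 ≤ C)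
    (h₁ : ∀ u, |φ₁ u| ≤ C * globalMaxwellian u) (h₂ : ∀ u, |φ₂ u| ≤ C * globalMaxwellian u)
    (v : E) :
    gainWith B φ₁ globalMaxwellian v + gainWith B φ₂ globalMaxwellian v =
      gainWith B (φ₁ + φ₂) globalMaxwellian v := by
  simp only [gainWith, Pi.add_apply]
  rw [← integral_add (integrable_gainSlice hB h₁m hC h₁ v) (integrable_gainSlice hB h₂m hC h₂ v)]
  refine integral_congr_ae (Eventually.of_forall fun w => ?_)
  simp only
  rw [← integral_add (integrable_gainSlice_sphere hB h₁m h₁ v w)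
    (integrable_gainSlice_sphere hB h₂m h₂ v w)]
  congr 1
  funext ω
  ring

/-- Sup bound on the gain term of a Maxwellian-bounded density: `|∫∫ B φ(v') M| ≤ C κ (1+|v|) M(v)`
with the constant `κ` of `exists_kernel_bounds`. [folklore] -/
theorem abs_gainWith_le_of_kernel_bounds {κ : ℝ} {b : E → ℝ}
    (hgainC : ∀ C : ℝ, 0 ≤ C → ∀ φ : E → ℝ, (∀ u, |φ u| ≤ C * globalMaxwellian u) → ∀ v,
        (∀ w, ‖∫ ω, B (v, w) ω * (φ (collide ω (v, w)).1 * globalMaxwellian (collide ω (v, w)).2)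
            ∂sphereMeasure‖ ≤ C * ((1 + ‖v‖) * globalMaxwellian v) * b w) ∧
        ∫ w, ‖∫ ω, B (v, w) ω * (φ (collide ω (v, w)).1 * globalMaxwellian (collide ω (v, w)).2)
            ∂sphereMeasure‖ ≤ C * κ * ((1 + ‖v‖) * globalMaxwellian v))
    {C : ℝ} (hC : 0 ≤ C) {φ : E → ℝ} (hφ : ∀ u, |φ u| ≤ C * globalMaxwellian u) (v : E) :
    |gainWith B φ globalMaxwellian v| ≤ C * κ * ((1 + ‖v‖) * globalMaxwellian v) := by
  rw [gainWith, ← Real.norm_eq_abs]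
  exact (norm_integral_le_integral_norm _).trans (hgainC C hC φ hφ v).2

/-- `∫₀ᵀ ν e^{-ν(T-τ)} dτ = 1 - e^{-νT}`. [folklore] -/
theorem integral_mul_exp_neg_mul_sub (ν T : ℝ) :
    ∫ τ in (0:ℝ)..T, ν * exp (-(ν * (T - τ))) = 1 - exp (-(ν * T)) := by
  have h : ∀ τ ∈ uIcc 0 T,
      HasDerivAt (fun τ => exp (-(ν * (T - τ)))) (ν * exp (-(ν * (T - τ)))) τ := by
    intro τ _
    have h1 : HasDerivAt (fun τ => -(ν * (T - τ))) ν τ := by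
      have h2 := (((hasDerivAt_id τ).const_sub T).const_mul ν).neg
      simp only [id, mul_neg_one, neg_neg] at h2
      exact h2
    convert h1.exp using 1
    ring
  rw [intervalIntegral.integral_eq_sub_of_hasDerivAt h
    ((by fun_prop : Continuous fun τ => ν * exp (-(ν * (T - τ)))).intervalIntegrable _ _)]
  simp

end VelocityOps2

/-! ## C. The exponential Duhamel map on a geometry and its monotone iteration -/

section Scheme

variable {d : Type*} [Fintype d] {X : Type*} [TopologicalSpace X]
  {B : EuclideanSpace ℝ d × EuclideanSpace ℝ d → sphere (0 : EuclideanSpace ℝ d) 1 → ℝ}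

/-- Joint continuity of the gain term of a jointly continuous, Maxwellian-bounded
`g : ℝ → X → ℝ^d → ℝ` in `((τ, z), v)`. [folklore] -/
theorem continuous_gainWith_comp (hB : IsGradCutoffKernel B) (hBc : Continuous (Function.uncurry B))
    {g : ℝ → X → EuclideanSpace ℝ d → ℝ} (hg : Continuous fun p : ℝ × X × EuclideanSpace ℝ d => g p.1 p.2.1 p.2.2)
    {C : ℝ} (hC : 0 ≤ C) (hgb : ∀ τ z u, |g τ z u| ≤ C * globalMaxwellian u) :
    Continuous fun q : (ℝ × X) × EuclideanSpace ℝ d => gainWith B (g q.1.1 q.1.2) globalMaxwellian q.2 :=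
  continuous_gainWith_param hB hBc (Φ := fun r : ℝ × X => g r.1 r.2)
    (hg.comp (continuous_fst.fst.prodMk (continuous_fst.snd.prodMk continuous_snd))) hC
    (fun r u => hgb r.1 r.2 u)

/-- Slices of a jointly continuous `g` are measurable. [folklore] -/
theorem measurable_slice_of_continuous {g : ℝ → X → EuclideanSpace ℝ d → ℝ}
    (hg : Continuous fun p : ℝ × X × EuclideanSpace ℝ d => g p.1 p.2.1 p.2.2) (τ : ℝ) (z : X) :
    Measurable fun u => g τ z u :=
  (hg.comp (continuous_const.prodMk (continuous_const.prodMk continuous_id))).measurable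

variable (G : Geometry d X)

/-- **Continuity of the exponential Duhamel map.** For continuous data `f₀`, a continuous
translation action, a continuous Grad cut-off kernel and a jointly continuous Maxwellian-bounded
`g`, the function `(t, y, v) ↦ e^{-ν t⁺} f₀(y - t⁺v, v) + ∫₀^{t⁺} e^{-ν(t⁺-τ)} (K g)(τ, y-(t⁺-τ)v, v) dτ`
(`t⁺ = max t 0`, `ν` the loss frequency, `K` the gain term) is jointly continuous. [folklore] -/
theorem continuous_expDuhamel (hG : Continuous fun p : X × EuclideanSpace ℝ d => G.translate p.1 p.2)
    (hB : IsGradCutoffKernel B) (hBc : Continuous (Function.uncurry B))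
    {f₀ : X → EuclideanSpace ℝ d → ℝ} (hf₀ : Continuous (Function.uncurry f₀))
    {g : ℝ → X → EuclideanSpace ℝ d → ℝ} (hg : Continuous fun p : ℝ × X × EuclideanSpace ℝ d => g p.1 p.2.1 p.2.2)
    {C : ℝ} (hC : 0 ≤ C) (hgb : ∀ τ z u, |g τ z u| ≤ C * globalMaxwellian u) :
    Continuous fun p : ℝ × X × EuclideanSpace ℝ d =>
      exp (-(lossWith B 1 globalMaxwellian p.2.2 * max p.1 0)) *
          f₀ (G.translate p.2.1 (-(max p.1 0 • p.2.2))) p.2.2 +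
        ∫ τ in (0:ℝ)..max p.1 0, exp (-(lossWith B 1 globalMaxwellian p.2.2 * (max p.1 0 - τ))) *
          gainWith B (g τ (G.translate p.2.1 (-((max p.1 0 - τ) • p.2.2)))) globalMaxwellian p.2.2 := by
  have hν := continuous_lossWith_one_globalMaxwellian hB hBc
  have hK := continuous_gainWith_comp hB hBc hg hC hgb
  have ht : Continuous fun p : ℝ × X × EuclideanSpace ℝ d => max p.1 0 := continuous_fst.max continuous_const
  refine Continuous.add ?_ ?_
  · refine (((hν.comp continuous_snd.snd).mul ht).neg.rexp).mul ?_
    exact hf₀.comp ((hG.comp (continuous_snd.fst.prodMk ((ht.smul continuous_snd.snd).neg))).prodMk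
      continuous_snd.snd)
  · refine intervalIntegral.continuous_parametric_intervalIntegral_of_continuous (a₀ := 0) ?_ ht
    have h1 : Continuous fun q : (ℝ × X × EuclideanSpace ℝ d) × ℝ =>
        exp (-(lossWith B 1 globalMaxwellian q.1.2.2 * (max q.1.1 0 - q.2))) :=
      ((hν.comp continuous_fst.snd.snd).mul ((ht.comp continuous_fst).sub continuous_snd)).neg.rexp
    have h2 : Continuous fun q : (ℝ × X × EuclideanSpace ℝ d) × ℝ => gainWith B
        (g q.2 (G.translate q.1.2.1 (-((max q.1.1 0 - q.2) • q.1.2.2)))) globalMaxwellian q.1.2.2 :=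
      hK.comp ((continuous_snd.prodMk (hG.comp (continuous_fst.snd.fst.prodMk
        ((((ht.comp continuous_fst).sub continuous_snd).smul continuous_fst.snd.snd).neg)))).prodMk
        continuous_fst.snd.snd)
    exact h1.mul h2

/-- Continuity in `τ` of the integrand of the exponential Duhamel map. [folklore] -/
theorem continuous_expDuhamel_integrand (hG : Continuous fun p : X × EuclideanSpace ℝ d => G.translate p.1 p.2)
    (hB : IsGradCutoffKernel B) (hBc : Continuous (Function.uncurry B))
    {g : ℝ → X → EuclideanSpace ℝ d → ℝ} (hg : Continuous fun p : ℝ × X × EuclideanSpace ℝ d => g p.1 p.2.1 p.2.2)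
    {C : ℝ} (hC : 0 ≤ C) (hgb : ∀ τ z u, |g τ z u| ≤ C * globalMaxwellian u) (s : ℝ) (y : X)
    (v : EuclideanSpace ℝ d) :
    Continuous fun τ : ℝ => exp (-(lossWith B 1 globalMaxwellian v * (s - τ))) *
      gainWith B (g τ (G.translate y (-((s - τ) • v)))) globalMaxwellian v := by
  have hK := continuous_gainWith_comp hB hBc hg hC hgb
  refine ((continuous_const.mul (continuous_const.sub continuous_id)).neg.rexp).mul ?_
  exact hK.comp ((continuous_id.prodMk (hG.comp (continuous_const.prodMk
    (((continuous_const.sub continuous_id).smul continuous_const).neg)))).prodMk continuous_const)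

/-- **Monotonicity of the exponential Duhamel map** in the data and in the density (positivity
of the kernel: the maximum principle in integrated form). [folklore] -/
theorem expDuhamel_mono (hG : Continuous fun p : X × EuclideanSpace ℝ d => G.translate p.1 p.2)
    (hB : IsGradCutoffKernel B) (hBc : Continuous (Function.uncurry B))
    {f₀ f₀' : X → EuclideanSpace ℝ d → ℝ} (hle₀ : ∀ y v, f₀ y v ≤ f₀' y v)
    {g g' : ℝ → X → EuclideanSpace ℝ d → ℝ} (hg : Continuous fun p : ℝ × X × EuclideanSpace ℝ d => g p.1 p.2.1 p.2.2)
    (hg' : Continuous fun p : ℝ × X × EuclideanSpace ℝ d => g' p.1 p.2.1 p.2.2) {C : ℝ} (hC : 0 ≤ C)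
    (hgb : ∀ τ z u, |g τ z u| ≤ C * globalMaxwellian u)
    (hgb' : ∀ τ z u, |g' τ z u| ≤ C * globalMaxwellian u)
    (hle : ∀ τ, 0 ≤ τ → ∀ z u, g τ z u ≤ g' τ z u) (t : ℝ) (y : X) (v : EuclideanSpace ℝ d) :
    exp (-(lossWith B 1 globalMaxwellian v * max t 0)) *
          f₀ (G.translate y (-(max t 0 • v))) v +
        ∫ τ in (0:ℝ)..max t 0, exp (-(lossWith B 1 globalMaxwellian v * (max t 0 - τ))) *
          gainWith B (g τ (G.translate y (-((max t 0 - τ) • v)))) globalMaxwellian v ≤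
      exp (-(lossWith B 1 globalMaxwellian v * max t 0)) *
          f₀' (G.translate y (-(max t 0 • v))) v +
        ∫ τ in (0:ℝ)..max t 0, exp (-(lossWith B 1 globalMaxwellian v * (max t 0 - τ))) *
          gainWith B (g' τ (G.translate y (-((max t 0 - τ) • v)))) globalMaxwellian v := by
  refine add_le_add (mul_le_mul_of_nonneg_left (hle₀ _ _) (exp_pos _).le) ?_
  refine intervalIntegral.integral_mono_on (le_max_right t 0)
    ((continuous_expDuhamel_integrand G hG hB hBc hg hC hgb _ y v).intervalIntegrable _ _)
    ((continuous_expDuhamel_integrand G hG hB hBc hg' hC hgb' _ y v).intervalIntegrable _ _)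
    fun τ hτ => ?_
  refine mul_le_mul_of_nonneg_left ?_ (exp_pos _).le
  exact gainWith_mono_globalMaxwellian hB (measurable_slice_of_continuous hg _ _)
    (measurable_slice_of_continuous hg' _ _) hC (hgb _ _) (hgb' _ _) (hle τ hτ.1 _) v

omit [TopologicalSpace X] in
/-- The exponential Duhamel map of zero data at the zero density vanishes. [folklore] -/
theorem expDuhamel_zero (t : ℝ) (y : X) (v : EuclideanSpace ℝ d) :
    exp (-(lossWith B 1 globalMaxwellian v * max t 0)) *
          (0 : X → EuclideanSpace ℝ d → ℝ) (G.translate y (-(max t 0 • v))) v +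
        ∫ τ in (0:ℝ)..max t 0, exp (-(lossWith B 1 globalMaxwellian v * (max t 0 - τ))) *
          gainWith B ((0 : ℝ → X → EuclideanSpace ℝ d → ℝ) τ (G.translate y (-((max t 0 - τ) • v)))) globalMaxwellian v = 0 := by
  simp [gainWith_zero_globalMaxwellian]

omit [TopologicalSpace X] in
/-- **The Maxwellian is a fixed point**: with data `C M` and density `C M` the exponential
Duhamel map returns `C M` (`K(CM) = C M ν` and `e^{-νt} + ∫₀ᵗ ν e^{-ν(t-τ)} dτ = 1`). [folklore] -/
theorem expDuhamel_const (C t : ℝ) (y : X) (v : EuclideanSpace ℝ d) :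
    exp (-(lossWith B 1 globalMaxwellian v * max t 0)) *
          (fun (_ : X) (u : EuclideanSpace ℝ d) => C * globalMaxwellian u) (G.translate y (-(max t 0 • v))) v +
        ∫ τ in (0:ℝ)..max t 0, exp (-(lossWith B 1 globalMaxwellian v * (max t 0 - τ))) *
          gainWith B ((fun (_ : ℝ) (_ : X) (u : EuclideanSpace ℝ d) => C * globalMaxwellian u) τ (G.translate y (-((max t 0 - τ) • v)))) globalMaxwellian v = C * globalMaxwellian v := by
  simp only [gainWith_const_mul_globalMaxwellian]
  have h : ∫ τ in (0:ℝ)..max t 0, exp (-(lossWith B 1 globalMaxwellian v * (max t 0 - τ))) *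
      (C * globalMaxwellian v * lossWith B 1 globalMaxwellian v) =
      C * globalMaxwellian v * ∫ τ in (0:ℝ)..max t 0, lossWith B 1 globalMaxwellian v *
        exp (-(lossWith B 1 globalMaxwellian v * (max t 0 - τ))) := by
    rw [← intervalIntegral.integral_const_mul]
    refine intervalIntegral.integral_congr fun τ _ => ?_
    simp only
    ring
  rw [h, integral_mul_exp_neg_mul_sub]
  ring

omit [TopologicalSpace X] in
/-- For `t ≤ 0` the exponential Duhamel map returns the data. [folklore] -/
theorem expDuhamel_of_nonpos {f₀ : X → EuclideanSpace ℝ d → ℝ} {g : ℝ → X → EuclideanSpace ℝ d → ℝ} {t : ℝ} (ht : t ≤ 0) (y : X)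
    (v : EuclideanSpace ℝ d) :
    exp (-(lossWith B 1 globalMaxwellian v * max t 0)) *
          f₀ (G.translate y (-(max t 0 • v))) v +
        ∫ τ in (0:ℝ)..max t 0, exp (-(lossWith B 1 globalMaxwellian v * (max t 0 - τ))) *
          gainWith B (g τ (G.translate y (-((max t 0 - τ) • v)))) globalMaxwellian v = f₀ y v := by
  simp [max_eq_right ht]

/-- **Additivity of the exponential Duhamel map** in (data, density), for jointly continuous
Maxwellian-bounded densities. [folklore] -/
theorem expDuhamel_add (hG : Continuous fun p : X × EuclideanSpace ℝ d => G.translate p.1 p.2)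
    (hB : IsGradCutoffKernel B) (hBc : Continuous (Function.uncurry B))
    (f₀ f₀' : X → EuclideanSpace ℝ d → ℝ)
    {g g' : ℝ → X → EuclideanSpace ℝ d → ℝ} (hg : Continuous fun p : ℝ × X × EuclideanSpace ℝ d => g p.1 p.2.1 p.2.2)
    (hg' : Continuous fun p : ℝ × X × EuclideanSpace ℝ d => g' p.1 p.2.1 p.2.2) {C : ℝ} (hC : 0 ≤ C)
    (hgb : ∀ τ z u, |g τ z u| ≤ C * globalMaxwellian u)
    (hgb' : ∀ τ z u, |g' τ z u| ≤ C * globalMaxwellian u) (t : ℝ) (y : X) (v : EuclideanSpace ℝ d) :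
    (exp (-(lossWith B 1 globalMaxwellian v * max t 0)) *
          f₀ (G.translate y (-(max t 0 • v))) v +
        ∫ τ in (0:ℝ)..max t 0, exp (-(lossWith B 1 globalMaxwellian v * (max t 0 - τ))) *
          gainWith B (g τ (G.translate y (-((max t 0 - τ) • v)))) globalMaxwellian v) +
      (exp (-(lossWith B 1 globalMaxwellian v * max t 0)) *
          f₀' (G.translate y (-(max t 0 • v))) v +
        ∫ τ in (0:ℝ)..max t 0, exp (-(lossWith B 1 globalMaxwellian v * (max t 0 - τ))) *
          gainWith B (g' τ (G.translate y (-((max t 0 - τ) • v)))) globalMaxwellian v) =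
      exp (-(lossWith B 1 globalMaxwellian v * max t 0)) *
          (f₀ + f₀') (G.translate y (-(max t 0 • v))) v +
        ∫ τ in (0:ℝ)..max t 0, exp (-(lossWith B 1 globalMaxwellian v * (max t 0 - τ))) *
          gainWith B ((g + g') τ (G.translate y (-((max t 0 - τ) • v)))) globalMaxwellian v := by
  have hI := (continuous_expDuhamel_integrand G hG hB hBc hg hC hgb (max t 0) y v).intervalIntegrable
    (μ := volume) 0 (max t 0)
  have hI' := (continuous_expDuhamel_integrand G hG hB hBc hg' hC hgb' (max t 0) y v).intervalIntegrable
    (μ := volume) 0 (max t 0)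
  rw [add_add_add_comm, ← mul_add, ← intervalIntegral.integral_add hI hI']
  congr 1
  refine intervalIntegral.integral_congr fun τ _ => ?_
  simp only [Pi.add_apply]
  rw [← mul_add, gainWith_add_globalMaxwellian hB (measurable_slice_of_continuous hg _ _)
    (measurable_slice_of_continuous hg' _ _) hC (hgb _ _) (hgb' _ _)]

/-- **Dominated convergence for the exponential Duhamel map**: along a pointwise convergent
sequence of jointly continuous densities with a common Maxwellian bound. [folklore] -/
theorem tendsto_expDuhamel (hG : Continuous fun p : X × EuclideanSpace ℝ d => G.translate p.1 p.2)
    (hB : IsGradCutoffKernel B) (hBc : Continuous (Function.uncurry B)) (f₀ : X → EuclideanSpace ℝ d → ℝ)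
    {g : ℕ → ℝ → X → EuclideanSpace ℝ d → ℝ} {g' : ℝ → X → EuclideanSpace ℝ d → ℝ}
    (hg : ∀ n, Continuous fun p : ℝ × X × EuclideanSpace ℝ d => g n p.1 p.2.1 p.2.2) {C : ℝ} (hC : 0 ≤ C)
    (hgb : ∀ n τ z u, |g n τ z u| ≤ C * globalMaxwellian u)
    (hlim : ∀ τ z u, Tendsto (fun n => g n τ z u) atTop (𝓝 (g' τ z u))) (t : ℝ) (y : X) (v : EuclideanSpace ℝ d) :
    Tendsto (fun n => exp (-(lossWith B 1 globalMaxwellian v * max t 0)) *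
          f₀ (G.translate y (-(max t 0 • v))) v +
        ∫ τ in (0:ℝ)..max t 0, exp (-(lossWith B 1 globalMaxwellian v * (max t 0 - τ))) *
          gainWith B (g n τ (G.translate y (-((max t 0 - τ) • v)))) globalMaxwellian v) atTop
      (𝓝 (exp (-(lossWith B 1 globalMaxwellian v * max t 0)) *
          f₀ (G.translate y (-(max t 0 • v))) v +
        ∫ τ in (0:ℝ)..max t 0, exp (-(lossWith B 1 globalMaxwellian v * (max t 0 - τ))) *
          gainWith B (g' τ (G.translate y (-((max t 0 - τ) • v)))) globalMaxwellian v)) := by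
  obtain ⟨κ, hκ0, b, -, -, -, -, -, hgainC⟩ := exists_kernel_bounds hB
  refine tendsto_const_nhds.add ?_
  refine intervalIntegral.tendsto_integral_filter_of_dominated_convergence
    (fun _ => C * κ * ((1 + ‖v‖) * globalMaxwellian v)) ?_ ?_
    (intervalIntegrable_const (μ := volume)) ?_
  · exact Eventually.of_forall fun n =>
      (continuous_expDuhamel_integrand G hG hB hBc (hg n) hC (hgb n) (max t 0) y v).aestronglyMeasurable
  · refine Eventually.of_forall fun n => Eventually.of_forall fun τ hτ => ?_
    have hτ' : τ ≤ max t 0 := by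
      rcases mem_uIoc.1 hτ with h | h
      · exact h.2
      · exact h.2.trans (le_max_right _ _)
    rw [norm_mul, Real.norm_eq_abs, Real.norm_eq_abs, abs_of_nonneg (exp_pos _).le]
    have h1 : exp (-(lossWith B 1 globalMaxwellian v * (max t 0 - τ))) ≤ 1 := by
      rw [exp_le_one_iff, neg_nonpos]
      exact mul_nonneg (lossWith_one_globalMaxwellian_nonneg hB v) (by linarith)
    have h2 := abs_gainWith_le_of_kernel_bounds hgainC hC (hgb n τ _) v
      (φ := g n τ (G.translate y (-((max t 0 - τ) • v))))
    calc _ ≤ 1 * (C * κ * ((1 + ‖v‖) * globalMaxwellian v)) :=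
          mul_le_mul h1 h2 (abs_nonneg _) zero_le_one
      _ = _ := one_mul _
  · refine Eventually.of_forall fun τ _ => ?_
    exact (tendsto_gainWith_globalMaxwellian hB
      (fun n => measurable_slice_of_continuous (hg n) τ _) hC (fun n => hgb n τ _)
      (hlim τ _) v).const_mul _

end Scheme

/-! ## C'. The monotone iteration `fₙ₊₁ = Φ(fₙ)`, `f₀ = 0`, and its limit -/

section Iteration

variable {d : Type*} [Fintype d] {X : Type*} [TopologicalSpace X]
  {B : EuclideanSpace ℝ d × EuclideanSpace ℝ d → sphere (0 : EuclideanSpace ℝ d) 1 → ℝ}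

variable (G : Geometry d X)

/-- **The iterates are continuous and lie between `0` and `C M`** (induction: continuity from
`continuous_expDuhamel`, the bounds from monotonicity and the fixed point `C M`). Here `Φ` is the
exponential Duhamel map of the data `f₀`, characterised by `hΦ`. [folklore] -/
theorem iterate_expDuhamel_spec (hG : Continuous fun p : X × EuclideanSpace ℝ d => G.translate p.1 p.2)
    (hB : IsGradCutoffKernel B) (hBc : Continuous (Function.uncurry B))
    {f₀ : X → EuclideanSpace ℝ d → ℝ} (hf₀c : Continuous (Function.uncurry f₀)) (hf₀0 : ∀ y v, 0 ≤ f₀ y v)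
    {C : ℝ} (hC : 0 ≤ C) (hf₀b : ∀ y v, f₀ y v ≤ C * globalMaxwellian v)
    {Φ : (ℝ → X → EuclideanSpace ℝ d → ℝ) → ℝ → X → EuclideanSpace ℝ d → ℝ}
    (hΦ : ∀ g t y v, Φ g t y v =
      exp (-(lossWith B 1 globalMaxwellian v * max t 0)) *
          f₀ (G.translate y (-(max t 0 • v))) v +
        ∫ τ in (0:ℝ)..max t 0, exp (-(lossWith B 1 globalMaxwellian v * (max t 0 - τ))) *
          gainWith B (g τ (G.translate y (-((max t 0 - τ) • v)))) globalMaxwellian v) (n : ℕ) :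
    Continuous (fun p : ℝ × X × EuclideanSpace ℝ d => (Φ^[n] 0) p.1 p.2.1 p.2.2) ∧
      ∀ t y v, 0 ≤ (Φ^[n] 0) t y v ∧ (Φ^[n] 0) t y v ≤ C * globalMaxwellian v := by
  induction n with
  | zero =>
    simp only [Function.iterate_zero, id_eq, Pi.zero_apply]
    exact ⟨continuous_const, fun t y v => ⟨le_rfl, mul_nonneg hC (globalMaxwellian_pos _).le⟩⟩
  | succ n ih =>
    obtain ⟨ihc, ihb⟩ := ih
    have habs : ∀ τ z u, |(Φ^[n] 0) τ z u| ≤ C * globalMaxwellian u := fun τ z u =>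
      abs_le.2 ⟨by linarith [(ihb τ z u).1, mul_nonneg hC (globalMaxwellian_pos u).le], (ihb τ z u).2⟩
    have hCM : ∀ u : EuclideanSpace ℝ d, |C * globalMaxwellian u| ≤ C * globalMaxwellian u := fun u =>
      (abs_of_nonneg (mul_nonneg hC (globalMaxwellian_pos u).le)).le
    have h0b : ∀ u : EuclideanSpace ℝ d, |(0 : ℝ)| ≤ C * globalMaxwellian u := fun u => by
      rw [abs_zero]; exact mul_nonneg hC (globalMaxwellian_pos u).le
    rw [Function.iterate_succ_apply']
    refine ⟨?_, fun t y v => ⟨?_, ?_⟩⟩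
    · have h : (fun p : ℝ × X × EuclideanSpace ℝ d => Φ (Φ^[n] 0) p.1 p.2.1 p.2.2) = fun p : ℝ × X × EuclideanSpace ℝ d =>
          exp (-(lossWith B 1 globalMaxwellian p.2.2 * max p.1 0)) *
            f₀ (G.translate p.2.1 (-(max p.1 0 • p.2.2))) p.2.2 +
          ∫ τ in (0:ℝ)..max p.1 0, exp (-(lossWith B 1 globalMaxwellian p.2.2 * (max p.1 0 - τ))) *
            gainWith B ((Φ^[n] 0) τ (G.translate p.2.1 (-((max p.1 0 - τ) • p.2.2)))) globalMaxwellian p.2.2 := funext fun p => hΦ _ _ _ _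
      rw [h]
      exact continuous_expDuhamel G hG hB hBc hf₀c ihc hC habs
    · rw [hΦ]
      refine (expDuhamel_zero (B := B) G t y v).symm.le.trans ?_
      exact expDuhamel_mono G hG hB hBc (f₀ := 0) (f₀' := f₀) (fun y v => hf₀0 y v)
        (g := 0) (g' := Φ^[n] 0) continuous_const ihc hC (fun _ _ u => h0b u) habs
        (fun τ _ z u => (ihb τ z u).1) t y v
    · rw [hΦ]
      refine le_trans ?_ (expDuhamel_const (B := B) G C t y v).le
      exact expDuhamel_mono G hG hB hBc (f₀' := fun _ u => C * globalMaxwellian u) hf₀b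
        (g' := fun _ _ u => C * globalMaxwellian u) ihc
        (continuous_const.mul (continuous_globalMaxwellian.comp continuous_snd.snd)) hC habs
        (fun _ _ u => hCM u) (fun τ _ z u => (ihb τ z u).2) t y v

/-- **The iteration is increasing**: `Φⁿ(0) ≤ Φⁿ⁺¹(0)` (monotonicity of `Φ`, starting from
`0 ≤ Φ(0)`). [folklore] -/
theorem iterate_expDuhamel_mono (hG : Continuous fun p : X × EuclideanSpace ℝ d => G.translate p.1 p.2)
    (hB : IsGradCutoffKernel B) (hBc : Continuous (Function.uncurry B))
    {f₀ : X → EuclideanSpace ℝ d → ℝ} (hf₀c : Continuous (Function.uncurry f₀)) (hf₀0 : ∀ y v, 0 ≤ f₀ y v)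
    {C : ℝ} (hC : 0 ≤ C) (hf₀b : ∀ y v, f₀ y v ≤ C * globalMaxwellian v)
    {Φ : (ℝ → X → EuclideanSpace ℝ d → ℝ) → ℝ → X → EuclideanSpace ℝ d → ℝ}
    (hΦ : ∀ g t y v, Φ g t y v =
      exp (-(lossWith B 1 globalMaxwellian v * max t 0)) *
          f₀ (G.translate y (-(max t 0 • v))) v +
        ∫ τ in (0:ℝ)..max t 0, exp (-(lossWith B 1 globalMaxwellian v * (max t 0 - τ))) *
          gainWith B (g τ (G.translate y (-((max t 0 - τ) • v)))) globalMaxwellian v) (n : ℕ) (t : ℝ) (y : X) (v : EuclideanSpace ℝ d) :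
    (Φ^[n] 0) t y v ≤ (Φ^[n + 1] 0) t y v := by
  induction n generalizing t y v with
  | zero =>
    simp only [Function.iterate_zero, id_eq, Pi.zero_apply]
    exact ((iterate_expDuhamel_spec G hG hB hBc hf₀c hf₀0 hC hf₀b hΦ 1).2 t y v).1
  | succ n ih =>
    obtain ⟨hcn, hbn⟩ := iterate_expDuhamel_spec G hG hB hBc hf₀c hf₀0 hC hf₀b hΦ n
    obtain ⟨hcn1, hbn1⟩ := iterate_expDuhamel_spec G hG hB hBc hf₀c hf₀0 hC hf₀b hΦ (n + 1)
    have habs : ∀ τ z u, |(Φ^[n] 0) τ z u| ≤ C * globalMaxwellian u := fun τ z u =>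
      abs_le.2 ⟨by linarith [(hbn τ z u).1, mul_nonneg hC (globalMaxwellian_pos u).le], (hbn τ z u).2⟩
    have habs1 : ∀ τ z u, |(Φ^[n + 1] 0) τ z u| ≤ C * globalMaxwellian u := fun τ z u =>
      abs_le.2 ⟨by linarith [(hbn1 τ z u).1, mul_nonneg hC (globalMaxwellian_pos u).le],
        (hbn1 τ z u).2⟩
    rw [Function.iterate_succ_apply' Φ (n + 1), Function.iterate_succ_apply' Φ n, hΦ, hΦ]
    rw [Function.iterate_succ_apply'] at hcn1 habs1 ih
    exact expDuhamel_mono G hG hB hBc (fun _ _ => le_rfl) hcn hcn1 hC habs habs1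
      (fun τ _ z u => ih τ z u) t y v

/-- **Convergence of the iteration** to its pointwise supremum. [folklore] -/
theorem tendsto_iterate_expDuhamel (hG : Continuous fun p : X × EuclideanSpace ℝ d => G.translate p.1 p.2)
    (hB : IsGradCutoffKernel B) (hBc : Continuous (Function.uncurry B))
    {f₀ : X → EuclideanSpace ℝ d → ℝ} (hf₀c : Continuous (Function.uncurry f₀)) (hf₀0 : ∀ y v, 0 ≤ f₀ y v)
    {C : ℝ} (hC : 0 ≤ C) (hf₀b : ∀ y v, f₀ y v ≤ C * globalMaxwellian v)
    {Φ : (ℝ → X → EuclideanSpace ℝ d → ℝ) → ℝ → X → EuclideanSpace ℝ d → ℝ}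
    (hΦ : ∀ g t y v, Φ g t y v =
      exp (-(lossWith B 1 globalMaxwellian v * max t 0)) *
          f₀ (G.translate y (-(max t 0 • v))) v +
        ∫ τ in (0:ℝ)..max t 0, exp (-(lossWith B 1 globalMaxwellian v * (max t 0 - τ))) *
          gainWith B (g τ (G.translate y (-((max t 0 - τ) • v)))) globalMaxwellian v) (t : ℝ) (y : X) (v : EuclideanSpace ℝ d) :
    Tendsto (fun n => (Φ^[n] 0) t y v) atTop (𝓝 (⨆ n, (Φ^[n] 0) t y v)) :=
  tendsto_atTop_ciSup (monotone_nat_of_le_succ fun n =>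
    iterate_expDuhamel_mono G hG hB hBc hf₀c hf₀0 hC hf₀b hΦ n t y v)
    ⟨C * globalMaxwellian v, by
      rintro _ ⟨n, rfl⟩
      exact ((iterate_expDuhamel_spec G hG hB hBc hf₀c hf₀0 hC hf₀b hΦ n).2 t y v).2⟩

/-- The limit lies between `0` and `C M`. [folklore] -/
theorem iSup_iterate_expDuhamel_mem (hG : Continuous fun p : X × EuclideanSpace ℝ d => G.translate p.1 p.2)
    (hB : IsGradCutoffKernel B) (hBc : Continuous (Function.uncurry B))
    {f₀ : X → EuclideanSpace ℝ d → ℝ} (hf₀c : Continuous (Function.uncurry f₀)) (hf₀0 : ∀ y v, 0 ≤ f₀ y v)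
    {C : ℝ} (hC : 0 ≤ C) (hf₀b : ∀ y v, f₀ y v ≤ C * globalMaxwellian v)
    {Φ : (ℝ → X → EuclideanSpace ℝ d → ℝ) → ℝ → X → EuclideanSpace ℝ d → ℝ}
    (hΦ : ∀ g t y v, Φ g t y v =
      exp (-(lossWith B 1 globalMaxwellian v * max t 0)) *
          f₀ (G.translate y (-(max t 0 • v))) v +
        ∫ τ in (0:ℝ)..max t 0, exp (-(lossWith B 1 globalMaxwellian v * (max t 0 - τ))) *
          gainWith B (g τ (G.translate y (-((max t 0 - τ) • v)))) globalMaxwellian v) (t : ℝ) (y : X) (v : EuclideanSpace ℝ d) :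
    0 ≤ (⨆ n, (Φ^[n] 0) t y v) ∧ (⨆ n, (Φ^[n] 0) t y v) ≤ C * globalMaxwellian v := by
  have hb : BddAbove (range fun n => (Φ^[n] 0) t y v) := ⟨C * globalMaxwellian v, by
    rintro _ ⟨n, rfl⟩
    exact ((iterate_expDuhamel_spec G hG hB hBc hf₀c hf₀0 hC hf₀b hΦ n).2 t y v).2⟩
  refine ⟨le_ciSup_of_le hb 0 ?_, ciSup_le fun n => ?_⟩
  · simp
  · exact ((iterate_expDuhamel_spec G hG hB hBc hf₀c hf₀0 hC hf₀b hΦ n).2 t y v).2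

/-- The velocity slices of the limit are measurable (pointwise limits of continuous functions).
[folklore] -/
theorem measurable_iSup_iterate_expDuhamel (hG : Continuous fun p : X × EuclideanSpace ℝ d => G.translate p.1 p.2)
    (hB : IsGradCutoffKernel B) (hBc : Continuous (Function.uncurry B))
    {f₀ : X → EuclideanSpace ℝ d → ℝ} (hf₀c : Continuous (Function.uncurry f₀)) (hf₀0 : ∀ y v, 0 ≤ f₀ y v)
    {C : ℝ} (hC : 0 ≤ C) (hf₀b : ∀ y v, f₀ y v ≤ C * globalMaxwellian v)
    {Φ : (ℝ → X → EuclideanSpace ℝ d → ℝ) → ℝ → X → EuclideanSpace ℝ d → ℝ}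
    (hΦ : ∀ g t y v, Φ g t y v =
      exp (-(lossWith B 1 globalMaxwellian v * max t 0)) *
          f₀ (G.translate y (-(max t 0 • v))) v +
        ∫ τ in (0:ℝ)..max t 0, exp (-(lossWith B 1 globalMaxwellian v * (max t 0 - τ))) *
          gainWith B (g τ (G.translate y (-((max t 0 - τ) • v)))) globalMaxwellian v) (τ : ℝ) (z : X) :
    Measurable fun u => ⨆ n, (Φ^[n] 0) τ z u :=
  measurable_of_tendsto_metrizable
    (fun n => measurable_slice_of_continuous
      (iterate_expDuhamel_spec G hG hB hBc hf₀c hf₀0 hC hf₀b hΦ n).1 τ z)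
    (tendsto_pi_nhds.2 fun u => tendsto_iterate_expDuhamel G hG hB hBc hf₀c hf₀0 hC hf₀b hΦ τ z u)

/-- **The limit is a fixed point of `Φ`** (dominated convergence in `Φ(fₙ) = fₙ₊₁`). [folklore] -/
theorem iSup_iterate_expDuhamel_eq (hG : Continuous fun p : X × EuclideanSpace ℝ d => G.translate p.1 p.2)
    (hB : IsGradCutoffKernel B) (hBc : Continuous (Function.uncurry B))
    {f₀ : X → EuclideanSpace ℝ d → ℝ} (hf₀c : Continuous (Function.uncurry f₀)) (hf₀0 : ∀ y v, 0 ≤ f₀ y v)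
    {C : ℝ} (hC : 0 ≤ C) (hf₀b : ∀ y v, f₀ y v ≤ C * globalMaxwellian v)
    {Φ : (ℝ → X → EuclideanSpace ℝ d → ℝ) → ℝ → X → EuclideanSpace ℝ d → ℝ}
    (hΦ : ∀ g t y v, Φ g t y v =
      exp (-(lossWith B 1 globalMaxwellian v * max t 0)) *
          f₀ (G.translate y (-(max t 0 • v))) v +
        ∫ τ in (0:ℝ)..max t 0, exp (-(lossWith B 1 globalMaxwellian v * (max t 0 - τ))) *
          gainWith B (g τ (G.translate y (-((max t 0 - τ) • v)))) globalMaxwellian v) (t : ℝ) (y : X) (v : EuclideanSpace ℝ d) :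
    (⨆ n, (Φ^[n] 0) t y v) = Φ (fun t y v => ⨆ n, (Φ^[n] 0) t y v) t y v := by
  have hT := tendsto_iterate_expDuhamel G hG hB hBc hf₀c hf₀0 hC hf₀b hΦ
  have h1 : Tendsto (fun n => (Φ^[n + 1] 0) t y v) atTop (𝓝 (⨆ n, (Φ^[n] 0) t y v)) :=
    (hT t y v).comp (tendsto_add_atTop_nat 1)
  have habs : ∀ n τ z u, |(Φ^[n] 0) τ z u| ≤ C * globalMaxwellian u := fun n τ z u => by
    have h := (iterate_expDuhamel_spec G hG hB hBc hf₀c hf₀0 hC hf₀b hΦ n).2 τ z u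
    exact abs_le.2 ⟨by linarith [h.1, mul_nonneg hC (globalMaxwellian_pos u).le], h.2⟩
  have h2 : Tendsto (fun n => (Φ^[n + 1] 0) t y v) atTop
      (𝓝 (Φ (fun t y v => ⨆ n, (Φ^[n] 0) t y v) t y v)) := by
    have h : (fun n => (Φ^[n + 1] 0) t y v) = fun n =>
        exp (-(lossWith B 1 globalMaxwellian v * max t 0)) *
          f₀ (G.translate y (-(max t 0 • v))) v +
        ∫ τ in (0:ℝ)..max t 0, exp (-(lossWith B 1 globalMaxwellian v * (max t 0 - τ))) *
          gainWith B ((Φ^[n] 0) τ (G.translate y (-((max t 0 - τ) • v)))) globalMaxwellian v := funext fun n => by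
      rw [Function.iterate_succ_apply', hΦ]
    rw [h, hΦ]
    exact tendsto_expDuhamel G hG hB hBc f₀
      (fun n => (iterate_expDuhamel_spec G hG hB hBc hf₀c hf₀0 hC hf₀b hΦ n).1) hC habs
      (fun τ z u => hT τ z u) t y v
  exact tendsto_nhds_unique h1 h2

end Iteration

/-! ## D. Auxiliary real-variable lemmas -/

section Aux

/-- A function which is an increasing pointwise limit of continuous functions, and whose
complement to a continuous function is one too, is continuous (lower plus upper
semicontinuity). [folklore] -/
theorem continuous_of_monotone_approx {P : Type*} [TopologicalSpace P] {F K : ℕ → P → ℝ}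
    {f k c : P → ℝ} (hFc : ∀ n, Continuous (F n)) (hKc : ∀ n, Continuous (K n))
    (hc : Continuous c) (hFle : ∀ n p, F n p ≤ f p) (hKle : ∀ n p, K n p ≤ k p)
    (hF : ∀ p, Tendsto (fun n => F n p) atTop (𝓝 (f p)))
    (hK : ∀ p, Tendsto (fun n => K n p) atTop (𝓝 (k p))) (hsum : ∀ p, f p + k p = c p) :
    Continuous f := by
  refine continuous_iff_continuousAt.2 fun p => tendsto_order.2 ⟨fun a ha => ?_, fun a ha => ?_⟩
  · obtain ⟨n, hn⟩ := ((hF p).eventually (lt_mem_nhds ha)).exists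
    filter_upwards [(hFc n).continuousAt.eventually (lt_mem_nhds hn)] with q hq
    exact hq.trans_le (hFle n q)
  · have hk : c p - a < k p := by linarith [hsum p]
    obtain ⟨n, hn⟩ := ((hK p).eventually (lt_mem_nhds hk)).exists
    have hcont : Continuous fun q => c q - K n q := hc.sub (hKc n)
    have hlt : c p - K n p < a := by linarith
    filter_upwards [hcont.continuousAt.eventually (gt_mem_nhds hlt)] with q hq
    linarith [hsum q, hKle n q]

/-- `∫ₐᵗ e^{c(τ-a)} dτ = (e^{c(t-a)} - 1)/c` for `c ≠ 0`. [folklore] -/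
theorem integral_exp_mul_sub {c : ℝ} (hc : c ≠ 0) (a t : ℝ) :
    ∫ τ in a..t, exp (c * (τ - a)) = (exp (c * (t - a)) - 1) / c := by
  have h : ∀ τ ∈ uIcc a t,
      HasDerivAt (fun τ => exp (c * (τ - a)) / c) (exp (c * (τ - a))) τ := by
    intro τ _
    have h1 : HasDerivAt (fun τ => c * (τ - a)) c τ := by
      have h2 := ((hasDerivAt_id τ).sub_const a).const_mul c
      simp only [mul_one] at h2
      exact h2
    exact (h1.exp.div_const c).congr_deriv (by rw [mul_div_assoc, div_self hc, mul_one])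
  rw [intervalIntegral.integral_eq_sub_of_hasDerivAt h
    ((by fun_prop : Continuous fun τ => exp (c * (τ - a))).intervalIntegrable _ _)]
  simp only [sub_self, mul_zero, exp_zero]
  ring

end Aux

/-! ## E. Uniqueness on short strips and for the exponential Duhamel equation -/

section Strip

variable {d : Type*} [Fintype d] {X : Type*} [TopologicalSpace X]
  {B : EuclideanSpace ℝ d × EuclideanSpace ℝ d → sphere (0 : EuclideanSpace ℝ d) 1 → ℝ}

omit [TopologicalSpace X] in
/-- **The short-time weighted estimate.** There is a strip width `T₀ > 0` (depending only on the
kernel) such that any `u`, Maxwellian-bounded on a time strip `[a, a + T₀]` and controlled there by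
a Duhamel-type inequality `|u(t, y, v)| ≤ |∫ₐᵗ D|` with
`|D(τ)| ≤ |∫∫ B u(τ, z(τ), v') M| + ν(v) |u(τ, z(τ), v)|`, vanishes on the strip: with the weight
`W = M(v) e^{Λ(τ-a)(1+|v|²)}`, `Λ = 8κ + 1`, `T₀ = 1/(4Λ)`, a bound `|u| ≤ N W` improves to
`|u| ≤ (N/2) W` (`exists_kernel_bounds`, `|v'|² ≤ |v|² + |v_*|²`), hence `u = 0`. No measurability
of `u` is needed. [folklore] -/
theorem exists_strip_width (hB : IsGradCutoffKernel B) :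
    ∃ T₀ : ℝ, 0 < T₀ ∧ ∀ (u : ℝ → X → EuclideanSpace ℝ d → ℝ) (a C₀ : ℝ),
      (∀ τ ∈ Icc a (a + T₀), ∀ (z : X) (w : EuclideanSpace ℝ d), |u τ z w| ≤ C₀ * globalMaxwellian w) →
      (∀ t ∈ Icc a (a + T₀), ∀ (y : X) (v : EuclideanSpace ℝ d), ∃ (D : ℝ → ℝ) (z : ℝ → X),
          |u t y v| ≤ ‖∫ τ in a..t, D τ‖ ∧
          ∀ τ ∈ Icc a t, |D τ| ≤ |gainWith B (u τ (z τ)) globalMaxwellian v| +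
            lossWith B 1 globalMaxwellian v * |u τ (z τ) v|) →
      ∀ t ∈ Icc a (a + T₀), ∀ (y : X) (v : EuclideanSpace ℝ d), u t y v = 0 := by
  obtain ⟨κ, hκ0, b, -, -, -, hlossκ, hgain, -⟩ := exists_kernel_bounds hB
  set Λ : ℝ := 8 * κ + 1 with hΛ
  have hΛ0 : 0 < Λ := by positivity
  refine ⟨1 / (4 * Λ), by positivity, fun u a C₀ hbd hrepr => ?_⟩
  set T₀ : ℝ := 1 / (4 * Λ) with hT₀
  set C₁ : ℝ := max C₀ 0 with hC₁
  have hC₁0 : 0 ≤ C₁ := le_max_right _ _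
  set W : ℝ → EuclideanSpace ℝ d → ℝ := fun τ w => globalMaxwellian w * exp (Λ * (τ - a) * (1 + ‖w‖ ^ 2)) with hW
  have key : ∀ m : ℕ, ∀ τ ∈ Icc a (a + T₀), ∀ (z : X) (w : EuclideanSpace ℝ d),
      |u τ z w| ≤ C₁ * (1 / 2) ^ m * W τ w := by
    intro m
    induction m with
    | zero =>
      intro τ hτ z w
      have hMw := globalMaxwellian_pos w
      have h1 : |u τ z w| ≤ C₁ * globalMaxwellian w :=
        (hbd τ hτ z w).trans (mul_le_mul_of_nonneg_right (le_max_left _ _) hMw.le)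
      rw [pow_zero, mul_one]
      refine h1.trans (mul_le_mul_of_nonneg_left ?_ hC₁0)
      refine le_mul_of_one_le_right hMw.le (one_le_exp ?_)
      exact mul_nonneg (mul_nonneg hΛ0.le (sub_nonneg.2 hτ.1)) (by positivity)
    | succ m ih =>
      intro t ht y v
      have hMv := globalMaxwellian_pos v
      obtain ⟨D, z, hle, hD⟩ := hrepr t ht y v
      set N : ℝ := C₁ * (1 / 2) ^ m with hN
      have hN0 : 0 ≤ N := by positivity
      have hDb : ∀ τ ∈ Icc a t, |D τ| ≤ 2 * (N * κ) * ((1 + ‖v‖) * W τ v) := by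
        intro τ hτ
        have hτ' : τ ∈ Icc a (a + T₀) := ⟨hτ.1, hτ.2.trans ht.2⟩
        have hs0 : 0 ≤ Λ * (τ - a) := mul_nonneg hΛ0.le (sub_nonneg.2 hτ.1)
        have hs : Λ * (τ - a) ≤ 1 / 4 := by
          have h1 : τ - a ≤ T₀ := by linarith [hτ'.2]
          calc Λ * (τ - a) ≤ Λ * T₀ := mul_le_mul_of_nonneg_left h1 hΛ0.le
            _ = 1 / 4 := by rw [hT₀]; field_simp
        have hφ : ∀ w', |u τ (z τ) w'| ≤
            N * (globalMaxwellian w' * exp (Λ * (τ - a) * (1 + ‖w'‖ ^ 2))) :=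
          fun w' => ih τ hτ' (z τ) w'
        have hg := (hgain (Λ * (τ - a)) N hs0 hs hN0 (u τ (z τ)) hφ v).2
        have hK : |gainWith B (u τ (z τ)) globalMaxwellian v| ≤ N * κ * ((1 + ‖v‖) * W τ v) := by
          rw [gainWith, ← Real.norm_eq_abs]
          exact (norm_integral_le_integral_norm _).trans hg
        have hL : lossWith B 1 globalMaxwellian v * |u τ (z τ) v| ≤
            N * κ * ((1 + ‖v‖) * W τ v) := by
          have h1 : lossWith B 1 globalMaxwellian v ≤ κ * (1 + ‖v‖) := by
            rw [lossWith_one_globalMaxwellian]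
            exact hlossκ v
          have hW0 : 0 ≤ N * W τ v := mul_nonneg hN0 (mul_nonneg hMv.le (exp_pos _).le)
          calc lossWith B 1 globalMaxwellian v * |u τ (z τ) v|
              ≤ (κ * (1 + ‖v‖)) * (N * W τ v) := mul_le_mul h1 (hφ v) (abs_nonneg _) (by positivity)
            _ = N * κ * ((1 + ‖v‖) * W τ v) := by ring
        calc |D τ| ≤ _ := hD τ hτ
          _ ≤ N * κ * ((1 + ‖v‖) * W τ v) + N * κ * ((1 + ‖v‖) * W τ v) := add_le_add hK hL
          _ = 2 * (N * κ) * ((1 + ‖v‖) * W τ v) := by ring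
      set c : ℝ := Λ * (1 + ‖v‖ ^ 2) with hc
      have hc0 : 0 < c := by positivity
      have hWv : ∀ τ, W τ v = globalMaxwellian v * exp (c * (τ - a)) := fun τ => by
        simp only [hW, hc]
        congr 1
        congr 1
        ring
      have hcont : Continuous fun τ => 2 * (N * κ) * ((1 + ‖v‖) * W τ v) := by
        simp only [hWv]
        fun_prop
      have hint : ‖∫ τ in a..t, D τ‖ ≤ ∫ τ in a..t, 2 * (N * κ) * ((1 + ‖v‖) * W τ v) :=
        intervalIntegral.norm_integral_le_of_norm_le ht.1
          (Eventually.of_forall fun τ (hτ : τ ∈ Ioc a t) =>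
            (show ‖D τ‖ ≤ 2 * (N * κ) * ((1 + ‖v‖) * W τ v) by
              rw [Real.norm_eq_abs]; exact hDb τ ⟨hτ.1.le, hτ.2⟩))
          (hcont.intervalIntegrable _ _)
      have hI : ∫ τ in a..t, 2 * (N * κ) * ((1 + ‖v‖) * W τ v) =
          2 * (N * κ) * ((1 + ‖v‖) * globalMaxwellian v) * ((exp (c * (t - a)) - 1) / c) := by
        simp only [hWv]
        rw [← integral_exp_mul_sub hc0.ne' a t, ← intervalIntegral.integral_const_mul]
        refine intervalIntegral.integral_congr fun τ _ => ?_
        ring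
      have hratio : 2 * κ * (1 + ‖v‖) / c ≤ 1 / 2 := by
        have h1 : 1 + ‖v‖ ≤ 2 * (1 + ‖v‖ ^ 2) := by nlinarith [sq_nonneg (‖v‖ - 1 / 4)]
        have h2 : 2 * κ * (1 + ‖v‖) ≤ 2 * κ * (2 * (1 + ‖v‖ ^ 2)) :=
          mul_le_mul_of_nonneg_left h1 (by positivity)
        rw [div_le_iff₀ hc0, hc, hΛ]
        nlinarith [h2, sq_nonneg ‖v‖, hκ0]
      have hfac0 : 0 ≤ 2 * (N * κ) * ((1 + ‖v‖) * globalMaxwellian v) := by positivity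
      calc |u t y v| ≤ ‖∫ τ in a..t, D τ‖ := hle
        _ ≤ ∫ τ in a..t, 2 * (N * κ) * ((1 + ‖v‖) * W τ v) := hint
        _ = 2 * (N * κ) * ((1 + ‖v‖) * globalMaxwellian v) * ((exp (c * (t - a)) - 1) / c) := hI
        _ ≤ 2 * (N * κ) * ((1 + ‖v‖) * globalMaxwellian v) * (exp (c * (t - a)) / c) :=
            mul_le_mul_of_nonneg_left (div_le_div_of_nonneg_right (by linarith) hc0.le) hfac0
        _ = N * (2 * κ * (1 + ‖v‖) / c) * (globalMaxwellian v * exp (c * (t - a))) := by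
            rw [div_eq_mul_inv, div_eq_mul_inv]
            ring
        _ ≤ N * (1 / 2) * (globalMaxwellian v * exp (c * (t - a))) :=
            mul_le_mul_of_nonneg_right (mul_le_mul_of_nonneg_left hratio hN0)
              (mul_nonneg hMv.le (exp_pos _).le)
        _ = C₁ * (1 / 2) ^ (m + 1) * W t v := by
            rw [hWv, hN, pow_succ]
            ring
  intro t ht y v
  have hlim : Tendsto (fun m : ℕ => C₁ * (1 / 2 : ℝ) ^ m * W t v) atTop (𝓝 (C₁ * 0 * W t v)) :=
    ((tendsto_pow_atTop_nhds_zero_of_lt_one (by norm_num) (by norm_num)).const_mul C₁).mul_const _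
  rw [mul_zero, zero_mul] at hlim
  exact abs_nonpos_iff.1 (ge_of_tendsto' hlim fun m => key m t ht y v)

variable (G : Geometry d X)

omit [TopologicalSpace X] in
/-- **Uniqueness of Maxwellian-bounded solutions of the exponential Duhamel equation**
`h = Φ(h)` (measurable velocity slices, integrable Duhamel integrands): two such solutions agree,
by `exists_strip_width` on consecutive strips `[kT₀, (k+1)T₀]` (on each strip the difference
`u = h₁ - h₂` satisfies `u(t) = ∫ₐᵗ e^{-ν(t-τ)} (K u)(τ) dτ` once it vanishes before `a`).
[folklore] -/
theorem expDuhamel_fixedPoint_unique (hB : IsGradCutoffKernel B) {f₀ : X → EuclideanSpace ℝ d → ℝ}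
    {Φ : (ℝ → X → EuclideanSpace ℝ d → ℝ) → ℝ → X → EuclideanSpace ℝ d → ℝ}
    (hΦ : ∀ g t y v, Φ g t y v =
      exp (-(lossWith B 1 globalMaxwellian v * max t 0)) *
          f₀ (G.translate y (-(max t 0 • v))) v +
        ∫ τ in (0:ℝ)..max t 0, exp (-(lossWith B 1 globalMaxwellian v * (max t 0 - τ))) *
          gainWith B (g τ (G.translate y (-((max t 0 - τ) • v)))) globalMaxwellian v)
    {h₁ h₂ : ℝ → X → EuclideanSpace ℝ d → ℝ} (hfix₁ : ∀ t y v, h₁ t y v = Φ h₁ t y v)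
    (hfix₂ : ∀ t y v, h₂ t y v = Φ h₂ t y v)
    (hm₁ : ∀ τ z, Measurable (h₁ τ z)) (hm₂ : ∀ τ z, Measurable (h₂ τ z)) {C : ℝ} (hC : 0 ≤ C)
    (hb₁ : ∀ τ z u, |h₁ τ z u| ≤ C * globalMaxwellian u)
    (hb₂ : ∀ τ z u, |h₂ τ z u| ≤ C * globalMaxwellian u)
    (hi₁ : ∀ (s a' b' : ℝ) (y : X) (v : EuclideanSpace ℝ d), IntervalIntegrable (fun τ =>
      exp (-(lossWith B 1 globalMaxwellian v * (s - τ))) *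
        gainWith B (h₁ τ (G.translate y (-((s - τ) • v)))) globalMaxwellian v) volume a' b')
    (hi₂ : ∀ (s a' b' : ℝ) (y : X) (v : EuclideanSpace ℝ d), IntervalIntegrable (fun τ =>
      exp (-(lossWith B 1 globalMaxwellian v * (s - τ))) *
        gainWith B (h₂ τ (G.translate y (-((s - τ) • v)))) globalMaxwellian v) volume a' b')
    (t : ℝ) (y : X) (v : EuclideanSpace ℝ d) : h₁ t y v = h₂ t y v := by
  obtain ⟨T₀, hT₀, hstrip⟩ := exists_strip_width (X := X) hB
  have hneg : ∀ t ≤ (0:ℝ), ∀ (y : X) (v : EuclideanSpace ℝ d), h₁ t y v = h₂ t y v := fun t ht y v => by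
    rw [hfix₁, hfix₂, hΦ, hΦ, expDuhamel_of_nonpos (B := B) G ht, expDuhamel_of_nonpos (B := B) G ht]
  have hind : ∀ k : ℕ, ∀ t ∈ Icc (0:ℝ) (k * T₀), ∀ (y : X) (v : EuclideanSpace ℝ d), h₁ t y v = h₂ t y v := by
    intro k
    induction k with
    | zero =>
      intro t ht y v
      rw [Nat.cast_zero, zero_mul] at ht
      exact hneg t ht.2 y v
    | succ k ih =>
      intro t ht y v
      set a : ℝ := k * T₀ with ha
      have ha0 : 0 ≤ a := by positivity
      rcases le_or_gt t a with hta | hta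
      · exact ih t ⟨ht.1, hta⟩ y v
      have hsucc : ((k + 1 : ℕ) : ℝ) * T₀ = a + T₀ := by push_cast; ring
      rw [hsucc] at ht
      have hz := hstrip (fun t y v => h₁ t y v - h₂ t y v) a (C + C) ?_ ?_ t ⟨hta.le, ht.2⟩ y v
      · exact sub_eq_zero.1 hz
      · intro τ _ z w
        show |h₁ τ z w - h₂ τ z w| ≤ (C + C) * globalMaxwellian w
        calc |h₁ τ z w - h₂ τ z w| ≤ |h₁ τ z w| + |h₂ τ z w| := abs_sub _ _
          _ ≤ C * globalMaxwellian w + C * globalMaxwellian w := add_le_add (hb₁ τ z w) (hb₂ τ z w)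
          _ = (C + C) * globalMaxwellian w := by ring
      · intro t ht y v
        have ht0 : 0 ≤ t := ha0.trans ht.1
        have hmax : max t 0 = t := max_eq_left ht0
        refine ⟨fun τ => exp (-(lossWith B 1 globalMaxwellian v * (t - τ))) *
            gainWith B (h₁ τ (G.translate y (-((t - τ) • v)))) globalMaxwellian v -
          exp (-(lossWith B 1 globalMaxwellian v * (t - τ))) *
            gainWith B (h₂ τ (G.translate y (-((t - τ) • v)))) globalMaxwellian v,
          fun τ => G.translate y (-((t - τ) • v)), ?_, ?_⟩
        · have hI₁ := hi₁ t 0 t y v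
          have hI₂ := hi₂ t 0 t y v
          have hI₁a := hi₁ t 0 a y v
          have hI₂a := hi₂ t 0 a y v
          have hI₁b := hi₁ t a t y v
          have hI₂b := hi₂ t a t y v
          have hu : h₁ t y v - h₂ t y v = ∫ τ in a..t,
              (exp (-(lossWith B 1 globalMaxwellian v * (t - τ))) *
                gainWith B (h₁ τ (G.translate y (-((t - τ) • v)))) globalMaxwellian v -
              exp (-(lossWith B 1 globalMaxwellian v * (t - τ))) *
                gainWith B (h₂ τ (G.translate y (-((t - τ) • v)))) globalMaxwellian v) := by
            rw [hfix₁, hfix₂, hΦ, hΦ, hmax, add_sub_add_left_eq_sub,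
              ← intervalIntegral.integral_sub hI₁ hI₂,
              ← intervalIntegral.integral_add_adjacent_intervals (b := a) (hI₁a.sub hI₂a)
                (hI₁b.sub hI₂b)]
            rw [intervalIntegral.integral_congr (g := fun _ => (0:ℝ)) ?_, intervalIntegral.integral_zero,
              zero_add]
            intro τ hτ
            rw [uIcc_of_le ha0] at hτ
            have heq : h₁ τ (G.translate y (-((t - τ) • v))) = h₂ τ (G.translate y (-((t - τ) • v))) :=
              funext fun w => ih τ hτ _ w
            simp only [heq, sub_self]
          rw [hu, Real.norm_eq_abs]
        · intro τ hτ
          have hsub := gainWith_sub_globalMaxwellian hB (hm₁ τ (G.translate y (-((t - τ) • v))))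
            (hm₂ τ (G.translate y (-((t - τ) • v)))) hC (hb₁ τ _) (hb₂ τ _) v
          have he : exp (-(lossWith B 1 globalMaxwellian v * (t - τ))) ≤ 1 := by
            rw [exp_le_one_iff, neg_nonpos]
            exact mul_nonneg (lossWith_one_globalMaxwellian_nonneg hB v) (sub_nonneg.2 hτ.2)
          calc |exp (-(lossWith B 1 globalMaxwellian v * (t - τ))) *
                gainWith B (h₁ τ (G.translate y (-((t - τ) • v)))) globalMaxwellian v -
              exp (-(lossWith B 1 globalMaxwellian v * (t - τ))) *
                gainWith B (h₂ τ (G.translate y (-((t - τ) • v)))) globalMaxwellian v|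
              = exp (-(lossWith B 1 globalMaxwellian v * (t - τ))) *
                |gainWith B (h₁ τ (G.translate y (-((t - τ) • v)))) globalMaxwellian v -
                  gainWith B (h₂ τ (G.translate y (-((t - τ) • v)))) globalMaxwellian v| := by
                rw [← mul_sub, abs_mul, abs_of_pos (exp_pos _)]
            _ ≤ 1 * |gainWith B (h₁ τ (G.translate y (-((t - τ) • v)))) globalMaxwellian v -
                  gainWith B (h₂ τ (G.translate y (-((t - τ) • v)))) globalMaxwellian v| :=
                mul_le_mul_of_nonneg_right he (abs_nonneg _)
            _ = |gainWith B (h₁ τ (G.translate y (-((t - τ) • v))) -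
                  h₂ τ (G.translate y (-((t - τ) • v)))) globalMaxwellian v| := by
                rw [one_mul, hsub]
            _ = |gainWith B ((fun t y v => h₁ t y v - h₂ t y v) τ (G.translate y (-((t - τ) • v))))
                  globalMaxwellian v| := rfl
            _ ≤ _ := le_add_of_nonneg_right
                (mul_nonneg (lossWith_one_globalMaxwellian_nonneg hB v) (abs_nonneg _))
  rcases le_or_gt t 0 with ht | ht
  · exact hneg t ht y v
  obtain ⟨k, hk⟩ := exists_nat_ge (t / T₀)
  refine hind k t ⟨ht.le, ?_⟩ y v
  rwa [div_le_iff₀ hT₀] at hk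

end Strip

/-! ## F. From the exponential form to Duhamel's formula; uniqueness of mild solutions -/

section Duhamel

variable {d : Type*} [Fintype d] {X : Type*} [TopologicalSpace X]
  {B : EuclideanSpace ℝ d × EuclideanSpace ℝ d → sphere (0 : EuclideanSpace ℝ d) 1 → ℝ}

variable (G : Geometry d X)

/-- The exponential Duhamel integrand of a pointwise limit of jointly continuous densities with
a common Maxwellian bound is interval integrable (measurable as a limit, dominated by a
continuous function). [folklore] -/
theorem intervalIntegrable_expDuhamel_integrand_of_tendsto
    (hG : Continuous fun p : X × EuclideanSpace ℝ d => G.translate p.1 p.2)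
    (hB : IsGradCutoffKernel B) (hBc : Continuous (Function.uncurry B))
    {g : ℕ → ℝ → X → EuclideanSpace ℝ d → ℝ} {g' : ℝ → X → EuclideanSpace ℝ d → ℝ}
    (hg : ∀ n, Continuous fun p : ℝ × X × EuclideanSpace ℝ d => g n p.1 p.2.1 p.2.2) {C : ℝ} (hC : 0 ≤ C)
    (hgb : ∀ n τ z u, |g n τ z u| ≤ C * globalMaxwellian u)
    (hlim : ∀ τ z u, Tendsto (fun n => g n τ z u) atTop (𝓝 (g' τ z u)))
    (hg'b : ∀ τ z u, |g' τ z u| ≤ C * globalMaxwellian u) (s a' b' : ℝ) (y : X) (v : EuclideanSpace ℝ d) :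
    IntervalIntegrable (fun τ => exp (-(lossWith B 1 globalMaxwellian v * (s - τ))) *
      gainWith B (g' τ (G.translate y (-((s - τ) • v)))) globalMaxwellian v) volume a' b' := by
  obtain ⟨κ, hκ0, b, -, -, -, -, -, hgainC⟩ := exists_kernel_bounds hB
  have hmeas : Measurable fun τ => exp (-(lossWith B 1 globalMaxwellian v * (s - τ))) *
      gainWith B (g' τ (G.translate y (-((s - τ) • v)))) globalMaxwellian v :=
    measurable_of_tendsto_metrizable
      (fun n => (continuous_expDuhamel_integrand G hG hB hBc (hg n) hC (hgb n) s y v).measurable)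
      (tendsto_pi_nhds.2 fun τ => (tendsto_gainWith_globalMaxwellian hB
        (fun n => measurable_slice_of_continuous (hg n) τ _) hC (fun n => hgb n τ _)
        (hlim τ _) v).const_mul _)
  have hdom : Continuous fun τ => exp (-(lossWith B 1 globalMaxwellian v * (s - τ))) *
      (C * κ * ((1 + ‖v‖) * globalMaxwellian v)) := by fun_prop
  refine (hdom.intervalIntegrable a' b').mono_fun' hmeas.aestronglyMeasurable
    (Eventually.of_forall fun τ => ?_)
  dsimp only
  rw [norm_mul, Real.norm_eq_abs, abs_of_pos (exp_pos _), Real.norm_eq_abs]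
  exact mul_le_mul_of_nonneg_left (abs_gainWith_le_of_kernel_bounds hgainC hC (hg'b τ _) v)
    (exp_pos _).le

/-- **From the exponential form to Duhamel's formula.** A jointly continuous, Maxwellian-bounded,
nonnegative fixed point of the exponential Duhamel map is a mild solution of the linear
Boltzmann equation on every `[0, T]`: along each characteristic
`F(t) = e^{-νt} F(0) + e^{-νt} ∫₀ᵗ e^{ντ} q(τ) dτ` is differentiable with `F' = q - ν F`
(fundamental theorem of calculus), and `q - ν F = Q_B(f, M)♯` by the gain/loss splitting.
[folklore] -/
theorem isMildLinearBoltzmannSolutionOn_of_expDuhamel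
    (hG : Continuous fun p : X × EuclideanSpace ℝ d => G.translate p.1 p.2)
    (hB : IsGradCutoffKernel B) (hBc : Continuous (Function.uncurry B)) {f₀ : X → EuclideanSpace ℝ d → ℝ}
    {Φ : (ℝ → X → EuclideanSpace ℝ d → ℝ) → ℝ → X → EuclideanSpace ℝ d → ℝ}
    (hΦ : ∀ g t y v, Φ g t y v =
      exp (-(lossWith B 1 globalMaxwellian v * max t 0)) *
          f₀ (G.translate y (-(max t 0 • v))) v +
        ∫ τ in (0:ℝ)..max t 0, exp (-(lossWith B 1 globalMaxwellian v * (max t 0 - τ))) *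
          gainWith B (g τ (G.translate y (-((max t 0 - τ) • v)))) globalMaxwellian v)
    {f : ℝ → X → EuclideanSpace ℝ d → ℝ} (hfix : ∀ t y v, f t y v = Φ f t y v)
    (hfc : Continuous fun p : ℝ × X × EuclideanSpace ℝ d => f p.1 p.2.1 p.2.2) {C : ℝ} (hC : 0 ≤ C)
    (hfb : ∀ t y v, |f t y v| ≤ C * globalMaxwellian v) (hf0 : ∀ t y v, 0 ≤ f t y v) (T : ℝ) :
    IsMildLinearBoltzmannSolutionOn T G B globalMaxwellian f := by
  have hK := continuous_gainWith_comp hB hBc hfc hC hfb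
  have hsplit : ∀ (x : X) (v : EuclideanSpace ℝ d) (τ : ℝ),
      alongFlow G (linearCollisionTerm B globalMaxwellian f) τ x v =
      gainWith B (f τ (G.translate x (τ • v))) globalMaxwellian v -
        f τ (G.translate x (τ • v)) v * lossWith B 1 globalMaxwellian v := by
    intro x v τ
    simp only [alongFlow, linearCollisionTerm_apply]
    exact collisionOpWith_globalMaxwellian_eq hB (measurable_slice_of_continuous hfc τ _) hC
      (hfb τ _) v
  have hchar : ∀ (x : X) (v : EuclideanSpace ℝ d), Continuous fun τ : ℝ => G.translate x (τ • v) := fun x v =>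
    hG.comp (continuous_const.prodMk (continuous_id.smul continuous_const))
  have hqc : ∀ (x : X) (v : EuclideanSpace ℝ d),
      Continuous fun τ : ℝ => gainWith B (f τ (G.translate x (τ • v))) globalMaxwellian v :=
    fun x v => hK.comp ((continuous_id.prodMk (hchar x v)).prodMk continuous_const)
  have hFlc : ∀ (x : X) (v : EuclideanSpace ℝ d), Continuous fun τ : ℝ => f τ (G.translate x (τ • v)) v :=
    fun x v => hfc.comp (continuous_id.prodMk ((hchar x v).prodMk continuous_const))
  have hcollc : ∀ (x : X) (v : EuclideanSpace ℝ d),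
      Continuous fun τ => alongFlow G (linearCollisionTerm B globalMaxwellian f) τ x v := by
    intro x v
    have h : (fun τ => alongFlow G (linearCollisionTerm B globalMaxwellian f) τ x v) = fun τ =>
        gainWith B (f τ (G.translate x (τ • v))) globalMaxwellian v -
          f τ (G.translate x (τ • v)) v * lossWith B 1 globalMaxwellian v := funext (hsplit x v)
    rw [h]
    exact (hqc x v).sub ((hFlc x v).mul continuous_const)
  refine ⟨fun t _ x v => hf0 t x v, fun x v t _ => (hcollc x v).intervalIntegrable _ _,
    fun x v t ht => ?_⟩
  set ν : ℝ := lossWith B 1 globalMaxwellian v with hν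
  set q : ℝ → ℝ := fun τ => gainWith B (f τ (G.translate x (τ • v))) globalMaxwellian v with hq
  have hqc' : Continuous q := hqc x v
  -- exponential representation along the characteristic
  have hstar : ∀ s, 0 ≤ s → f s (G.translate x (s • v)) v =
      exp (-(ν * s)) * f₀ x v + ∫ τ in (0:ℝ)..s, exp (-(ν * (s - τ))) * q τ := by
    intro s hs
    rw [hfix, hΦ, max_eq_left hs]
    have h1 : G.translate (G.translate x (s • v)) (-(s • v)) = x := by
      rw [Geometry.translate_add, add_neg_cancel, Geometry.translate_zero]
    have h2 : ∀ τ, G.translate (G.translate x (s • v)) (-((s - τ) • v)) = G.translate x (τ • v) :=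
      fun τ => by
        rw [Geometry.translate_add]
        congr 1
        rw [sub_smul]
        abel
    simp only [h1, h2, hq, hν]
  set P : ℝ → ℝ := fun s => ∫ τ in (0:ℝ)..s, exp (ν * τ) * q τ with hP
  have hPint : ∀ s, ∫ τ in (0:ℝ)..s, exp (-(ν * (s - τ))) * q τ = exp (-(ν * s)) * P s := by
    intro s
    simp only [hP]
    rw [← intervalIntegral.integral_const_mul]
    refine intervalIntegral.integral_congr fun τ _ => ?_
    rw [← mul_assoc, ← exp_add]
    congr 1
    congr 1
    ring
  have hPc : Continuous fun τ => exp (ν * τ) * q τ := by fun_prop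
  have hPd : ∀ s, HasDerivAt P (exp (ν * s) * q s) s := fun s =>
    (hPc.integral_hasStrictDerivAt 0 s).hasDerivAt
  set Fexp : ℝ → ℝ := fun s => exp (-(ν * s)) * (f₀ x v + P s) with hFexp
  have hFd : ∀ s, HasDerivAt Fexp (q s - ν * Fexp s) s := by
    intro s
    have he : HasDerivAt (fun s => exp (-(ν * s))) (-ν * exp (-(ν * s))) s := by
      have h1 : HasDerivAt (fun s => -(ν * s)) (-ν) s := by
        have h2 := ((hasDerivAt_id s).const_mul ν).neg
        simp only [id, mul_one] at h2
        exact h2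
      exact h1.exp.congr_deriv (by ring)
    have h2 := he.mul ((hPd s).const_add (f₀ x v))
    refine h2.congr_deriv ?_
    simp only [hFexp]
    have h3 : exp (-(ν * s)) * (exp (ν * s) * q s) = q s := by
      rw [← mul_assoc, ← exp_add, neg_add_cancel, exp_zero, one_mul]
    linear_combination h3
  have hFexpc : Continuous Fexp := continuous_iff_continuousAt.2 fun s => (hFd s).continuousAt
  have hFc' : Continuous fun s => q s - ν * Fexp s := hqc'.sub (continuous_const.mul hFexpc)
  have hFTC : ∫ s in (0:ℝ)..t, (q s - ν * Fexp s) = Fexp t - Fexp 0 :=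
    intervalIntegral.integral_eq_sub_of_hasDerivAt (fun s _ => hFd s) (hFc'.intervalIntegrable _ _)
  have hFl : ∀ s, 0 ≤ s → Fexp s = f s (G.translate x (s • v)) v := fun s hs => by
    rw [hstar s hs, hPint s, hFexp]
    ring
  have ht0 : (0:ℝ) ≤ t := ht.1
  show f t (G.translate x (t • v)) v = f 0 x v +
    ∫ τ in (0:ℝ)..t, alongFlow G (linearCollisionTerm B globalMaxwellian f) τ x v
  have hf0x : f 0 x v = Fexp 0 := by
    rw [hFl 0 le_rfl, zero_smul, Geometry.translate_zero]
  rw [← hFl t ht0, hf0x]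
  have hI : ∫ τ in (0:ℝ)..t, alongFlow G (linearCollisionTerm B globalMaxwellian f) τ x v =
      ∫ s in (0:ℝ)..t, (q s - ν * Fexp s) := by
    refine intervalIntegral.integral_congr fun s hs => ?_
    rw [uIcc_of_le ht0] at hs
    rw [hsplit, hFl s hs.1]
    simp only [hq]
    ring
  rw [hI, hFTC]
  ring

omit [TopologicalSpace X] in
/-- Inverting free transport: `(y - t v) + t v = y`. [folklore] -/
theorem translate_translate_neg (y : X) (w : EuclideanSpace ℝ d) :
    G.translate (G.translate y (-w)) w = y := by
  rw [Geometry.translate_add, neg_add_cancel, Geometry.translate_zero]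

/-- **Uniqueness of mild solutions of the linear Boltzmann equation** in the Maxwellian-weighted
continuous class: two solutions on `t ≥ 0` with the same data agree (`exists_strip_width` on
consecutive strips; on a strip the difference `u = g - f` satisfies
`u(t, y, v) = ∫ₐᵗ Q_B(u, M)♯ dτ` and `Q_B(u, M) = K u - ν u` by the gain/loss splitting, which
applies because the slices of `f, g` are continuous and Maxwellian-bounded). [folklore] -/
theorem mildLinearBoltzmann_unique (hB : IsGradCutoffKernel B) {f g : ℝ → X → EuclideanSpace ℝ d → ℝ}
    (hf : ∀ T, 0 ≤ T →
      IsMildLinearBoltzmannSolutionOn T G B globalMaxwellian f ∧ IsMaxwellianBoundedOn T f)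
    (hg : ∀ T, 0 ≤ T →
      IsMildLinearBoltzmannSolutionOn T G B globalMaxwellian g ∧ IsMaxwellianBoundedOn T g)
    (h0 : g 0 = f 0) (t : ℝ) (ht : 0 ≤ t) : g t = f t := by
  obtain ⟨T₀, hT₀, hstrip⟩ := exists_strip_width (X := X) hB
  have hslice : ∀ {h : ℝ → X → EuclideanSpace ℝ d → ℝ} {T : ℝ}, IsMaxwellianBoundedOn T h → ∀ τ ∈ Icc 0 T,
      ∀ z : X, Continuous fun u : EuclideanSpace ℝ d => h τ z u := by
    intro h T hh τ hτ z
    exact hh.1.comp_continuous (continuous_const.prodMk (continuous_const.prodMk continuous_id))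
      fun u => mk_mem_prod hτ (mem_univ _)
  have hind : ∀ k : ℕ, ∀ t ∈ Icc (0:ℝ) (k * T₀), ∀ (y : X) (v : EuclideanSpace ℝ d), g t y v = f t y v := by
    intro k
    induction k with
    | zero =>
      intro t ht y v
      rw [Nat.cast_zero, zero_mul] at ht
      have h : t = 0 := le_antisymm ht.2 ht.1
      subst h
      exact congrFun (congrFun h0 y) v
    | succ k ih =>
      intro t ht y v
      set a : ℝ := k * T₀ with ha
      have ha0 : 0 ≤ a := by positivity
      rcases le_or_gt t a with hta | hta
      · exact ih t ⟨ht.1, hta⟩ y v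
      have hsucc : ((k + 1 : ℕ) : ℝ) * T₀ = a + T₀ := by push_cast; ring
      rw [hsucc] at ht
      set T : ℝ := a + T₀ with hT
      have hT0 : 0 ≤ T := by positivity
      obtain ⟨sf, hbf⟩ := hf T hT0
      obtain ⟨sg, hbg⟩ := hg T hT0
      obtain ⟨Cf, hCf⟩ := hbf.2
      obtain ⟨Cg, hCg⟩ := hbg.2
      set C₀ : ℝ := |Cg| + |Cf| with hC₀
      have hC₀0 : 0 ≤ C₀ := by positivity
      have hbg' : ∀ τ ∈ Icc 0 T, ∀ (z : X) (u : EuclideanSpace ℝ d), |g τ z u| ≤ C₀ * globalMaxwellian u :=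
        fun τ hτ z u => (hCg τ hτ z u).trans (mul_le_mul_of_nonneg_right
          ((le_abs_self _).trans (by rw [hC₀]; linarith [abs_nonneg Cf])) (globalMaxwellian_pos _).le)
      have hbf' : ∀ τ ∈ Icc 0 T, ∀ (z : X) (u : EuclideanSpace ℝ d), |f τ z u| ≤ C₀ * globalMaxwellian u :=
        fun τ hτ z u => (hCf τ hτ z u).trans (mul_le_mul_of_nonneg_right
          ((le_abs_self _).trans (by rw [hC₀]; linarith [abs_nonneg Cg])) (globalMaxwellian_pos _).le)
      have hz := hstrip (fun t y v => g t y v - f t y v) a C₀ ?_ ?_ t ⟨hta.le, ht.2⟩ y v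
      · exact sub_eq_zero.1 hz
      · intro τ hτ z w
        have hτT : τ ∈ Icc 0 T := ⟨ha0.trans hτ.1, hτ.2⟩
        show |g τ z w - f τ z w| ≤ C₀ * globalMaxwellian w
        calc |g τ z w - f τ z w| ≤ |g τ z w| + |f τ z w| := abs_sub _ _
          _ ≤ |Cg| * globalMaxwellian w + |Cf| * globalMaxwellian w :=
              add_le_add ((hCg τ hτT z w).trans
                  (mul_le_mul_of_nonneg_right (le_abs_self _) (globalMaxwellian_pos _).le))
                ((hCf τ hτT z w).trans
                  (mul_le_mul_of_nonneg_right (le_abs_self _) (globalMaxwellian_pos _).le))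
          _ = C₀ * globalMaxwellian w := by rw [hC₀]; ring
      · intro t ht y v
        have ht0 : 0 ≤ t := ha0.trans ht.1
        have htT : t ∈ Icc 0 T := ⟨ht0, ht.2⟩
        have haT : a ∈ Icc 0 T := ⟨ha0, by rw [hT]; linarith⟩
        set x : X := G.translate y (-(t • v)) with hx
        have hxy : G.translate x (t • v) = y := translate_translate_neg G y (t • v)
        refine ⟨fun τ => alongFlow G (linearCollisionTerm B globalMaxwellian g) τ x v -
            alongFlow G (linearCollisionTerm B globalMaxwellian f) τ x v,
          fun τ => G.translate x (τ • v), ?_, ?_⟩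
        · have hDg := sg.duhamel x v t htT
          have hDf := sf.duhamel x v t htT
          have hDga := sg.duhamel x v a haT
          have hDfa := sf.duhamel x v a haT
          have hIg := sg.intervalIntegrable x v t htT
          have hIf := sf.intervalIntegrable x v t htT
          have hIga := sg.intervalIntegrable x v a haT
          have hIfa := sf.intervalIntegrable x v a haT
          have eg : alongFlow G g t x v = g t y v := by simp only [alongFlow, hxy]
          have ef : alongFlow G f t x v = f t y v := by simp only [alongFlow, hxy]
          rw [eg] at hDg
          rw [ef] at hDf
          have h0x : g 0 x v = f 0 x v := congrFun (congrFun h0 x) v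
          have hua : alongFlow G g a x v = alongFlow G f a x v := by
            simp only [alongFlow]
            exact ih a ⟨ha0, le_rfl⟩ _ v
          have hu : g t y v - f t y v = ∫ τ in a..t,
              (alongFlow G (linearCollisionTerm B globalMaxwellian g) τ x v -
                alongFlow G (linearCollisionTerm B globalMaxwellian f) τ x v) := by
            rw [hDg, hDf, h0x, add_sub_add_left_eq_sub, ← intervalIntegral.integral_sub hIg hIf,
              ← intervalIntegral.integral_add_adjacent_intervals (b := a) (hIga.sub hIfa)
                ((hIga.sub hIfa).symm.trans (hIg.sub hIf)),
              intervalIntegral.integral_sub hIga hIfa]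
            have e1 : ∫ τ in (0:ℝ)..a, alongFlow G (linearCollisionTerm B globalMaxwellian g) τ x v =
                alongFlow G g a x v - g 0 x v := by linarith [hDga]
            have e2 : ∫ τ in (0:ℝ)..a, alongFlow G (linearCollisionTerm B globalMaxwellian f) τ x v =
                alongFlow G f a x v - f 0 x v := by linarith [hDfa]
            rw [e1, e2, h0x, hua]
            ring
          rw [hu, Real.norm_eq_abs]
        · intro τ hτ
          have hτT : τ ∈ Icc 0 T := ⟨ha0.trans hτ.1, hτ.2.trans ht.2⟩
          have hmg := (hslice hbg τ hτT (G.translate x (τ • v))).measurable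
          have hmf := (hslice hbf τ hτT (G.translate x (τ • v))).measurable
          have hQg := collisionOpWith_globalMaxwellian_eq hB hmg hC₀0 (hbg' τ hτT _) v
          have hQf := collisionOpWith_globalMaxwellian_eq hB hmf hC₀0 (hbf' τ hτT _) v
          have hsub := gainWith_sub_globalMaxwellian hB hmg hmf hC₀0 (hbg' τ hτT _) (hbf' τ hτT _) v
          have hν0 := lossWith_one_globalMaxwellian_nonneg hB v
          show |alongFlow G (linearCollisionTerm B globalMaxwellian g) τ x v -
              alongFlow G (linearCollisionTerm B globalMaxwellian f) τ x v| ≤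
            |gainWith B (fun w => g τ (G.translate x (τ • v)) w - f τ (G.translate x (τ • v)) w)
                globalMaxwellian v| +
              lossWith B 1 globalMaxwellian v *
                |g τ (G.translate x (τ • v)) v - f τ (G.translate x (τ • v)) v|
          simp only [alongFlow, linearCollisionTerm_apply]
          rw [hQg, hQf]
          have h : gainWith B (g τ (G.translate x (τ • v))) globalMaxwellian v -
                g τ (G.translate x (τ • v)) v * lossWith B 1 globalMaxwellian v -
              (gainWith B (f τ (G.translate x (τ • v))) globalMaxwellian v -
                f τ (G.translate x (τ • v)) v * lossWith B 1 globalMaxwellian v) =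
              gainWith B (g τ (G.translate x (τ • v)) - f τ (G.translate x (τ • v))) globalMaxwellian v -
                (g τ (G.translate x (τ • v)) v - f τ (G.translate x (τ • v)) v) *
                  lossWith B 1 globalMaxwellian v := by
            rw [← hsub]
            ring
          rw [h]
          calc _ ≤ |gainWith B (g τ (G.translate x (τ • v)) - f τ (G.translate x (τ • v)))
                  globalMaxwellian v| +
                |(g τ (G.translate x (τ • v)) v - f τ (G.translate x (τ • v)) v) *
                  lossWith B 1 globalMaxwellian v| := abs_sub _ _
            _ = _ := by
                rw [abs_mul, abs_of_nonneg hν0, mul_comm _ (lossWith B 1 globalMaxwellian v)]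
                rfl
  funext y v
  obtain ⟨k, hk⟩ := exists_nat_ge (t / T₀)
  exact hind k t ⟨ht, by rwa [div_le_iff₀ hT₀] at hk⟩ y v

end Duhamel

end LinearBoltzmann

open LinearBoltzmann

/-! ## G. Global well-posedness of the linear Boltzmann equation -/

section Main

variable {d : Type*} [Fintype d] {X : Type*}

/-- **Global well-posedness of the linear Boltzmann equation** (discharge of
`existsUnique_mildLinearBoltzmann`; Bodineau–Gallagher–Saint-Raymond, Invent. Math. 203 (2016),
the linear Boltzmann equation (1.7)/(2.3) and its maximum principle, §3.3:
`sup_t φ_α(t) ≤ ‖ρ⁰‖_∞`; the classical monotone-scheme proof, cf. Cercignani–Illner–Pulvirenti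
1994 Ch. 8). Existence: the exponential (integrating-factor) form of Duhamel's formula,
`f = e^{-νt} f₀ + ∫₀ᵗ e^{-ν(t-τ)} K f`, is solved by the increasing iteration from `0`, which stays
below the stationary solution `C M` (maximum principle); the limit `f` is a fixed point by
dominated convergence, its complement `C M - f` is the limit of the iteration for the data
`C M - f₀` (additivity and uniqueness of bounded fixed points, `expDuhamel_fixedPoint_unique`), so
`f` is both lower and upper semicontinuous, hence continuous, and the exponential form integrates
back to Duhamel's formula (`isMildLinearBoltzmannSolutionOn_of_expDuhamel`). Uniqueness in the
Maxwellian-weighted continuous class is `mildLinearBoltzmann_unique` (weighted short-time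
contraction on strips, `exists_strip_width`).
[cite: BodineauGallagherSaintRaymond2016, §3.3 (linear Boltzmann equation (2.3), maximum principle)] -/
theorem existsUnique_mildLinearBoltzmann_holds :
    existsUnique_mildLinearBoltzmann (d := d) (X := X) := by
  intro _ G hG B hB hBc f₀ hf₀ h0 hbdd
  obtain ⟨C', hC'⟩ := hbdd
  set C : ℝ := max C' 0 with hCdef
  have hC : 0 ≤ C := le_max_right _ _
  have hM0 : ∀ v : EuclideanSpace ℝ d, 0 ≤ globalMaxwellian v := fun v => (globalMaxwellian_pos v).le
  have hf₀b : ∀ y v, f₀ y v ≤ C * globalMaxwellian v := fun y v =>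
    (hC' y v).trans (mul_le_mul_of_nonneg_right (le_max_left _ _) (hM0 v))
  -- complementary and constant data
  set k₀ : X → EuclideanSpace ℝ d → ℝ := fun y v => C * globalMaxwellian v - f₀ y v with hk₀
  have hk₀c : Continuous (Function.uncurry k₀) :=
    (continuous_const.mul (continuous_globalMaxwellian.comp continuous_snd)).sub hf₀
  have hk₀0 : ∀ y v, 0 ≤ k₀ y v := fun y v => sub_nonneg.2 (hf₀b y v)
  have hk₀b : ∀ y v, k₀ y v ≤ C * globalMaxwellian v := fun y v => sub_le_self _ (h0 y v)
  have hc₀c : Continuous (Function.uncurry fun (_ : X) (u : EuclideanSpace ℝ d) => C * globalMaxwellian u) :=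
    continuous_const.mul (continuous_globalMaxwellian.comp continuous_snd)
  have hc₀0 : ∀ (y : X) (v : EuclideanSpace ℝ d), 0 ≤ (fun (_ : X) (u : EuclideanSpace ℝ d) => C * globalMaxwellian u) y v :=
    fun _ v => mul_nonneg hC (hM0 v)
  have hc₀b : ∀ (y : X) (v : EuclideanSpace ℝ d),
      (fun (_ : X) (u : EuclideanSpace ℝ d) => C * globalMaxwellian u) y v ≤ C * globalMaxwellian v :=
    fun _ _ => le_rfl
  have hcg : Continuous fun p : ℝ × X × EuclideanSpace ℝ d =>
      (fun (_ : ℝ) (_ : X) (u : EuclideanSpace ℝ d) => C * globalMaxwellian u) p.1 p.2.1 p.2.2 :=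
    continuous_const.mul (continuous_globalMaxwellian.comp continuous_snd.snd)
  have hcgb : ∀ (τ : ℝ) (z : X) (u : EuclideanSpace ℝ d),
      |(fun (_ : ℝ) (_ : X) (u : EuclideanSpace ℝ d) => C * globalMaxwellian u) τ z u| ≤ C * globalMaxwellian u :=
    fun _ _ u => (abs_of_nonneg (mul_nonneg hC (hM0 u))).le
  -- the three exponential Duhamel maps
  set Φ : (ℝ → X → EuclideanSpace ℝ d → ℝ) → ℝ → X → EuclideanSpace ℝ d → ℝ := fun g t y v =>
    exp (-(lossWith B 1 globalMaxwellian v * max t 0)) *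
          f₀ (G.translate y (-(max t 0 • v))) v +
        ∫ τ in (0:ℝ)..max t 0, exp (-(lossWith B 1 globalMaxwellian v * (max t 0 - τ))) *
          gainWith B (g τ (G.translate y (-((max t 0 - τ) • v)))) globalMaxwellian v with hΦdef
  have hΦ : ∀ g t y v, Φ g t y v =
      exp (-(lossWith B 1 globalMaxwellian v * max t 0)) *
          f₀ (G.translate y (-(max t 0 • v))) v +
        ∫ τ in (0:ℝ)..max t 0, exp (-(lossWith B 1 globalMaxwellian v * (max t 0 - τ))) *
          gainWith B (g τ (G.translate y (-((max t 0 - τ) • v)))) globalMaxwellian v := fun _ _ _ _ => rfl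
  set Φk : (ℝ → X → EuclideanSpace ℝ d → ℝ) → ℝ → X → EuclideanSpace ℝ d → ℝ := fun g t y v =>
    exp (-(lossWith B 1 globalMaxwellian v * max t 0)) *
          k₀ (G.translate y (-(max t 0 • v))) v +
        ∫ τ in (0:ℝ)..max t 0, exp (-(lossWith B 1 globalMaxwellian v * (max t 0 - τ))) *
          gainWith B (g τ (G.translate y (-((max t 0 - τ) • v)))) globalMaxwellian v with hΦkdef
  have hΦk : ∀ g t y v, Φk g t y v =
      exp (-(lossWith B 1 globalMaxwellian v * max t 0)) *
          k₀ (G.translate y (-(max t 0 • v))) v +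
        ∫ τ in (0:ℝ)..max t 0, exp (-(lossWith B 1 globalMaxwellian v * (max t 0 - τ))) *
          gainWith B (g τ (G.translate y (-((max t 0 - τ) • v)))) globalMaxwellian v := fun _ _ _ _ => rfl
  set Φh : (ℝ → X → EuclideanSpace ℝ d → ℝ) → ℝ → X → EuclideanSpace ℝ d → ℝ := fun g t y v =>
    exp (-(lossWith B 1 globalMaxwellian v * max t 0)) *
          (fun (_ : X) (u : EuclideanSpace ℝ d) => C * globalMaxwellian u) (G.translate y (-(max t 0 • v))) v +
        ∫ τ in (0:ℝ)..max t 0, exp (-(lossWith B 1 globalMaxwellian v * (max t 0 - τ))) *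
          gainWith B (g τ (G.translate y (-((max t 0 - τ) • v)))) globalMaxwellian v with hΦhdef
  have hΦh : ∀ g t y v, Φh g t y v =
      exp (-(lossWith B 1 globalMaxwellian v * max t 0)) *
          (fun (_ : X) (u : EuclideanSpace ℝ d) => C * globalMaxwellian u) (G.translate y (-(max t 0 • v))) v +
        ∫ τ in (0:ℝ)..max t 0, exp (-(lossWith B 1 globalMaxwellian v * (max t 0 - τ))) *
          gainWith B (g τ (G.translate y (-((max t 0 - τ) • v)))) globalMaxwellian v := fun _ _ _ _ => rfl
  -- the iterations and their limits
  have specF := iterate_expDuhamel_spec G hG hB hBc hf₀ h0 hC hf₀b hΦ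
  have specK := iterate_expDuhamel_spec G hG hB hBc hk₀c hk₀0 hC hk₀b hΦk
  have specH := iterate_expDuhamel_spec G hG hB hBc hc₀c hc₀0 hC hc₀b hΦh
  have absF : ∀ n τ z u, |(Φ^[n] 0) τ z u| ≤ C * globalMaxwellian u := fun n τ z u => by
    have h := (specF n).2 τ z u
    exact abs_le.2 ⟨by linarith [h.1, mul_nonneg hC (hM0 u)], h.2⟩
  have absK : ∀ n τ z u, |(Φk^[n] 0) τ z u| ≤ C * globalMaxwellian u := fun n τ z u => by
    have h := (specK n).2 τ z u
    exact abs_le.2 ⟨by linarith [h.1, mul_nonneg hC (hM0 u)], h.2⟩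
  have absH : ∀ n τ z u, |(Φh^[n] 0) τ z u| ≤ C * globalMaxwellian u := fun n τ z u => by
    have h := (specH n).2 τ z u
    exact abs_le.2 ⟨by linarith [h.1, mul_nonneg hC (hM0 u)], h.2⟩
  have limF := tendsto_iterate_expDuhamel G hG hB hBc hf₀ h0 hC hf₀b hΦ
  have limK := tendsto_iterate_expDuhamel G hG hB hBc hk₀c hk₀0 hC hk₀b hΦk
  have limH := tendsto_iterate_expDuhamel G hG hB hBc hc₀c hc₀0 hC hc₀b hΦh
  set f : ℝ → X → EuclideanSpace ℝ d → ℝ := fun t y v => ⨆ n, (Φ^[n] 0) t y v with hfdef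
  set k : ℝ → X → EuclideanSpace ℝ d → ℝ := fun t y v => ⨆ n, (Φk^[n] 0) t y v with hkdef
  set h : ℝ → X → EuclideanSpace ℝ d → ℝ := fun t y v => ⨆ n, (Φh^[n] 0) t y v with hhdef
  have memF : ∀ t y v, 0 ≤ f t y v ∧ f t y v ≤ C * globalMaxwellian v :=
    iSup_iterate_expDuhamel_mem G hG hB hBc hf₀ h0 hC hf₀b hΦ
  have memH : ∀ t y v, 0 ≤ h t y v ∧ h t y v ≤ C * globalMaxwellian v :=
    iSup_iterate_expDuhamel_mem G hG hB hBc hc₀c hc₀0 hC hc₀b hΦh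
  have fixF : ∀ t y v, f t y v = Φ f t y v :=
    iSup_iterate_expDuhamel_eq G hG hB hBc hf₀ h0 hC hf₀b hΦ
  have fixH : ∀ t y v, h t y v = Φh h t y v :=
    iSup_iterate_expDuhamel_eq G hG hB hBc hc₀c hc₀0 hC hc₀b hΦh
  have measH : ∀ τ z, Measurable (h τ z) :=
    measurable_iSup_iterate_expDuhamel G hG hB hBc hc₀c hc₀0 hC hc₀b hΦh
  have habsf : ∀ t y v, |f t y v| ≤ C * globalMaxwellian v := fun t y v =>
    abs_le.2 ⟨by linarith [(memF t y v).1, mul_nonneg hC (hM0 v)], (memF t y v).2⟩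
  have habsh : ∀ t y v, |h t y v| ≤ C * globalMaxwellian v := fun t y v =>
    abs_le.2 ⟨by linarith [(memH t y v).1, mul_nonneg hC (hM0 v)], (memH t y v).2⟩
  -- the iterates of the constant data are the sums of the other two
  have hdata : f₀ + k₀ = fun (_ : X) (u : EuclideanSpace ℝ d) => C * globalMaxwellian u := by
    funext y v
    simp only [Pi.add_apply, hk₀]
    ring
  have hsum : ∀ n : ℕ, (Φh^[n] 0) = fun t y v => (Φ^[n] 0) t y v + (Φk^[n] 0) t y v := by
    intro n
    induction n with
    | zero =>
      funext t y v
      simp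
    | succ n ih =>
      funext t y v
      have hadd := expDuhamel_add G hG hB hBc f₀ k₀ (specF n).1 (specK n).1 hC (absF n) (absK n)
        t y v
      have hfun : (Φ^[n] 0 + Φk^[n] 0) = fun t y v => (Φ^[n] 0) t y v + (Φk^[n] 0) t y v := by
        funext t y v
        simp only [Pi.add_apply]
      rw [Function.iterate_succ_apply', Function.iterate_succ_apply', Function.iterate_succ_apply',
        hΦh, hΦ, hΦk, ih, hadd, hdata, hfun]
  have hfk : ∀ t y v, h t y v = f t y v + k t y v := fun t y v => by
    refine tendsto_nhds_unique (limH t y v) ?_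
    have hl := (limF t y v).add (limK t y v)
    simp only [hsum]
    exact hl
  -- the limit of the constant-data iteration is the Maxwellian: uniqueness of fixed points
  have hconst : ∀ t y v, h t y v = C * globalMaxwellian v := by
    intro t y v
    refine expDuhamel_fixedPoint_unique G hB (f₀ := fun (_ : X) (u : EuclideanSpace ℝ d) => C * globalMaxwellian u)
      hΦh (h₁ := h)
      (h₂ := fun (_ : ℝ) (_ : X) (u : EuclideanSpace ℝ d) => C * globalMaxwellian u) fixH ?_ measH
      (fun _ _ => (continuous_const.mul continuous_globalMaxwellian).measurable) hC habsh hcgb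
      ?_ ?_ t y v
    · intro t y v
      exact (expDuhamel_const (B := B) G C t y v).symm.trans
        (hΦh (fun (_ : ℝ) (_ : X) (u : EuclideanSpace ℝ d) => C * globalMaxwellian u) t y v).symm
    · intro s a' b' y v
      exact intervalIntegrable_expDuhamel_integrand_of_tendsto G hG hB hBc
        (g := fun n => Φh^[n] 0) (g' := h) (fun n => (specH n).1) hC absH limH habsh s a' b' y v
    · intro s a' b' y v
      exact (continuous_expDuhamel_integrand G hG hB hBc hcg hC hcgb s y v).intervalIntegrable _ _
  -- continuity of the limit: lower and upper semicontinuity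
  have hfcont : Continuous fun p : ℝ × X × EuclideanSpace ℝ d => f p.1 p.2.1 p.2.2 := by
    refine continuous_of_monotone_approx (F := fun n p => (Φ^[n] 0) p.1 p.2.1 p.2.2)
      (K := fun n p => (Φk^[n] 0) p.1 p.2.1 p.2.2) (k := fun p => k p.1 p.2.1 p.2.2)
      (c := fun p => C * globalMaxwellian p.2.2) (fun n => (specF n).1) (fun n => (specK n).1)
      (continuous_const.mul (continuous_globalMaxwellian.comp continuous_snd.snd))
      (fun n p => ?_) (fun n p => ?_) (fun p => limF _ _ _) (fun p => limK _ _ _) (fun p => ?_)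
    · exact (monotone_nat_of_le_succ fun n =>
        iterate_expDuhamel_mono G hG hB hBc hf₀ h0 hC hf₀b hΦ n p.1 p.2.1 p.2.2).ge_of_tendsto
        (limF _ _ _) n
    · exact (monotone_nat_of_le_succ fun n =>
        iterate_expDuhamel_mono G hG hB hBc hk₀c hk₀0 hC hk₀b hΦk n p.1 p.2.1 p.2.2).ge_of_tendsto
        (limK _ _ _) n
    · show f p.1 p.2.1 p.2.2 + k p.1 p.2.1 p.2.2 = C * globalMaxwellian p.2.2
      rw [← hfk]
      exact hconst _ _ _
  -- conclusion
  have hf0eq : f 0 = f₀ := by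
    funext y v
    rw [fixF 0 y v, hΦ]
    exact expDuhamel_of_nonpos (B := B) G le_rfl y v
  have hfT : ∀ T, 0 ≤ T →
      IsMildLinearBoltzmannSolutionOn T G B globalMaxwellian f ∧ IsMaxwellianBoundedOn T f :=
    fun T _ => ⟨isMildLinearBoltzmannSolutionOn_of_expDuhamel G hG hB hBc hΦ fixF hfcont hC habsf
      (fun t y v => (memF t y v).1) T, hfcont.continuousOn, C, fun t _ x v => habsf t x v⟩
  refine ⟨f, ⟨hf0eq, hfT⟩, fun g hg0 hg t ht => ?_⟩
  exact mildLinearBoltzmann_unique G hB hfT hg (hg0.trans hf0eq.symm) t ht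

end Main

end

end Literature.Analysis.FunctionSpaces
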